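import Mathlib.RingTheory.IntegralClosure.IntegrallyClosed
import Mathlib.RingTheory.RootsOfUnity.Complex
import Mathlib.LinearAlgebra.Matrix.IsDiag
import Mathlib.GroupTheory.OrderOfElement
import Literature.Computability.AlgebraicComplexity.Polystability
import Literature.Computability.AlgebraicComplexity.PolystabilityProofs
import Literature.Computability.AlgebraicComplexity.EquivariantDC
import Literature.Computability.AlgebraicComplexity.OrbitCoordinateRing
import Literature.Computability.AlgebraicComplexity.Hyperdeterminant
import Literature.Computability.AlgebraicComplexity.KumarLatinRectangles
import Literature.Computability.AlgebraicComplexity.StandardFamilies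
import Literature.Computability.AlgebraicComplexity.PencilFamily
import Literature.NumberTheory.DiophantineGeometry.SchurWeylPlethysm
import Literature.NumberTheory.DiophantineGeometry.SchurWeylPlethysmRenameProofs
import Literature.NumberTheory.DiophantineGeometry.DetStabilizerFrobeniusProofs
import Literature.Computability.AlgebraicComplexity.PerStabilizerMarcusMayProofs
import Mathlib.LinearAlgebra.Matrix.Kronecker
import Mathlib.GroupTheory.Perm.Cycle.Type
import HarnessLib

/-!
# Stabilizer periods, degree monoids and the fundamental invariant of forms
# (Bürgisser–Ikenmeyer 2017, §2–§3)

P. Bürgisser, C. Ikenmeyer, *Fundamental invariants of orbit closures*, J. Algebra **477** (2017)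
390–434 = arXiv:1511.02927 [BurgisserIkenmeyer2017]. This file types §2 (*Stabilizer period and
polystability of forms*) and §3 (*Fundamental invariant of forms*) statement by statement, in the
numbering of the arXiv version (shared counter per section; held text `paper:arxiv-1511.02927`,
chunk locators `pNNNN.txt:Lnn`; TeX line locators `main.tex Lnnn` of
`pub-gct/inputs/files/src/1511.02927/main.tex`). Typed literature for the cell `val-lit` (row
BI17-A); honest framing: nothing here is progress on VP versus VNP.

Setting of the paper: `Sym^D ℂ^m` = forms of degree `D` in `m` variables with the natural action of
`G = GL_m` (§2.1, L420); `D = 1` is excluded (L488) and from Def. 3.8 on `w ≠ 0` is polystable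
(L836). In the tree a form is `f : MvPolynomial (Fin m) ℂ` with `f.IsHomogeneous D`, `GL (Fin m) ℂ`
acts by `linSubst`/`linSubstRep` (`X_i ↦ ∑_j g_{ji} X_j`, `LinSubst.lean`; the paper's `g w = g^{⊗D} w`
on symmetric tensors, eq. (3.3) L1038, is the same action `w ↦ w ∘ gᵀ`), the stabilizer is
`linStabilizer f` (`EquivariantDC.lean`), polynomial functions on `Sym^D` are
`MvPolynomial (DegIdx σ D) k` evaluated at `formCoeff D f` with the contragredient action `coordRep`
and the orbit-closure coordinate ring `OrbitCoordRing f D = k[Sym^D] ⧸ I(GL · f)`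
(`OrbitCoordinateRing.lean`), and a form `w` is identified with its symmetric array `arrOf D w`
(`Hyperdeterminant.lean`; BI §3.1 "a map `v : [m]^D → ℂ` provides a coordinate description of the
tensor", L993).

## Coverage (source item → declaration → status)

§2.1 (L418–546, p0006):
* stabilizer `stab(w)` (2.1), L424 → CITE `linStabilizer`; `H = det(stab w)`, L430 →
  `stabilizerDetImage`; stabilizer period `a(w)`, L436 → `stabilizerPeriod` (order of `H`, with
  `0` encoding the printed `a(w) = ∞`, the `Nat.card` convention); trivial stabilizer, L428 →
  `HasTrivialStabilizer`.
* Lemma 2.1 (L439, p0006:L25) → `BI2017_lem_2_1` **proved**.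
* Def. 2.2 reduced stabilizer period `a'(w)` (L451, p0006:L36) → `reducedStabilizerPeriod`.
* "almost all `w` have stabilizer period `a(D,m)`" (L459) — generic statements are rendered by
  `IsZariskiGeneric D P` (a nonzero polynomial function on `Sym^D` off whose zero set `P` holds); the
  generic periods `a(D,m)`, `a'(D,m)`, `b(D,m)`, `e(D,m)` are not introduced as numbers but as
  `IsZariskiGeneric` statements about `stabilizerPeriod`, … .
* Matsumura–Monsky (generic forms have trivial stabilizer, `D > 2`, `m > 3`; L466) →
  `BI2017_matsumuraMonsky_trivialStabilizer` FACT.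
* Thm. 2.3 (L473, p0006:L56) → `BI2017_thm_2_3_open` (finite-stabilizer locus is nonempty open),
  `BI2017_thm_2_3_period` (`a'(D,m) = 1` except `a'(3,2) = a'(3,3) = a'(4,3) = 2`) FACTS;
  remark `a(2,m) = 2` (L482) → `BI2017_rem_quadratic_period` FACT.
* Prop. 2.4 (L494, p0006:L76) → `BI2017_prop_2_4_1` (stabilizer and period of `X_1⋯X_m`),
  `BI2017_prop_2_4_2` (of `X_1^D + ⋯ + X_m^D`) FACTS.
* Thm. 2.5 (Frobenius; L513, p0006:L93): stabilizer of `det_n` → CITE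
  `Literature.NumberTheory.DiophantineGeometry.frobenius_detPreserver_unimodular_sandwich`
  (`DetStabilizerFrobenius.lean`, discharged); period of `det_n` → `BI2017_thm_2_5_period` FACT,
  PROVED as `BI2017_thm_2_5_period_holds` (every stabilizer element is a Kronecker sandwich or a
  sandwich ∘ transposition, of determinant `1` resp. `sgn τ = (-1)^{n(n-1)/2}`).
* Thm. 2.6 (Marcus–May; L530, p0006:L109): stabilizer of `per_n`, `n > 2` → CITE
  `marcusMay1962_perPreserver_sandwich` (`PerStabilizerMarcusMay.lean`, discharged); period →
  `BI2017_thm_2_6_period` FACT, PROVED as `BI2017_thm_2_6_period_holds` (monomial sandwiches have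
  determinant `(sgn π sgn ρ)^n`; `-1` is attained by a row transposition for odd `n` and by the
  index transposition for `n ≡ 2 (mod 4)`).
§2.2 (L548–672, p0006–p0007):
* Def. 2.7 (L554) → CITE `IsPolystable` (`Polystability.lean`).
* Prop. 2.8 (L565, p0006:L140) → `BI2017_prop_2_8_diag` FACT, in the special case `R` ⊆ diagonal
  matrices (the case of all four applications in Cor. 2.9; `TODO(general form)`: `R` any reductive
  subgroup of `SL_m ∩ stab(w)` — Mathlib has no reductive algebraic subgroups).
* Cor. 2.9 (L611, p0007:L39): `det_n`, `per_n` → CITE `BurgisserIkenmeyer2017_polystable_det_per`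
  (PROVED, `BurgisserIkenmeyer2017_polystable_det_per_holds`, `PolystabilityProofs.lean`); the two
  remaining clauses `X_1⋯X_m`, `X_1^D + ⋯ + X_m^D` (`D > 1`) → `BI2017_cor_2_9_chow_powerSum` FACT.
* Prop. 2.10 (L633, p0007:L60) → `BI2017_prop_2_10` FACT. Prop. 2.11 (L655, p0007:L81) →
  `BI2017_prop_2_11` FACT (degree `D ≥ 1`: false for nonzero constants, see its docstring).
§2.3 (L674–700): numerical semigroups, Frobenius number, Rem. 2.12 (Sylvester
`g(a_1,a_2) = a_1 a_2 − a_1 − a_2`) → CITE Mathlib `Nat.frobeniusNumber_pair`; "NP-hard" not typed.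
§3 (L703–942, p0008–p0009):
* Def. 3.1 degree period `b(w) = (m/D) a(w)` (L713) → `degreePeriod`; eq. (3.1) `D b(w) = m a(w)`
  (L764) → `BI2017_eq_3_1` **proved** (from Lemma 2.1). `SL`-invariant polynomial functions on
  `Sym^D` (`O(Sym^D ℂ^m)^{SL_m}`, L709) → `IsSLInvariantCoord` (coordinates `DegIdx σ D`, action
  `coordRep`) with the bridge `IsSLInvariantCoord.isSLInvariantOnForms_rename` to `PencilFamily.lean`'s
  `IsSLInvariantOnForms` (all-monomial coordinates) **proved**; `slInvariantsOfDegree` = `O(Sym^D)^{SL}_d`.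
* the map `φ_w(g w) = det(g)^{a(w)}` (L723) is not introduced as a function on the orbit; Lemma
  3.2(1)(2) (L726; `O(Gw)` of the quasi-affine ORBIT) are not typed (no tree/Mathlib notion of the
  coordinate ring of the orbit); Lemma 3.2(3) in the form "`E(w) = b(w) E'(w)`" (L800) →
  `BI2017_lem_3_2_3` FACT.
* Def. 3.3 degree monoid `E(w)`, minimal degree `e(w)` (L772) → `degreeMonoid`, `minimalDegree`
  (rendering: `O(\overline{Gw})^{SL_m}_d ≠ 0` iff some `SL_m`-invariant homogeneous polynomial
  function of degree `d` on `Sym^D` does not vanish on `Gw`, i.e. is not in `I(GL·w)`; this uses that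
  `O(Sym^D ℂ^m)^{SL_m}_d → O(\overline{Gw})^{SL_m}_d` is onto (linear reductivity of `SL_m`), which
  the paper itself uses in the proof of Thm. 3.15, L1147).
* Thm. 3.4 (L784, p0008:L81) → `BI2017_thm_3_4` FACT. Def. 3.5 exponent monoid `E'(w)`, `e'(w)`
  (L792) → `exponentMonoid`, `minimalExponent`. Def. 3.6 generic degree monoid `E(D,m)`, `e(D,m)`
  (L804) → `genericDegreeMonoid`, `genericMinimalDegree`; "`E(w) = E(D,m)` for almost all `w`"
  (L813) → `BI2017_degreeMonoid_generic` FACT. Ex. 3.7 (L823; computed with SCHUR) →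
  `BI2017_ex_3_7` FACT.
* Def. 3.8 fundamental invariant `Φ_w` (L839) → `IsFundamentalInvariant` (predicate on polynomial
  representatives). Prop. 3.9(1) (L874) → `BI2017_prop_3_9_1` FACT; 3.9(2) (`O(Gw) =
  O(\overline{Gw})_{Φ_w}`) not typed (orbit coordinate ring, as above). Thm. 3.10 (L934, p0009:L39)
  → `BI2017_thm_3_10` FACT (`boundaryVanishingIdeal`; "not a valuation ring" clause not typed).
§3.1 (L944–1110, p0009–p0010):
* the tableau invariant `P_T` of eq. (3.4) (L1007) → `tableauInv β` for a bijection
  `β : [D] × [d] ≃ [m] × [s]` (the paper's `(ι,i) ↦ (T^{ι,i}, T_{ι,i})`, eq. (3.2) L974), and as a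
  polynomial function on `Sym^D`, `tableauInvPoly`; `P_{D,m}` of eq. (3.5) (L1018; Cayley 1843) is
  the row tableau `β = Equiv.prodComm` and EQUALS the tree's Cayley hyperdeterminant
  (`tableauInv_prodComm : tableauInv (Equiv.prodComm _ _) v = hyperdet v`, `rfl`), so
  `P_{D,m} = hyperdetPoly D t` → `cayleyP`.
* Thm. 3.11 (L1032, p0009:L146) → `BI2017_thm_3_11` (named statement for general `β`) and
  `BI2017_thm_3_11_holds` **proved** (following the printed proof: multilinear expansion, regrouping
  by boxes, Lemma 3.12 column by column); its case `P_{D,m}` is the tree's `hyperdet_tensorMul`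
  (`tableauInv_prodComm_tensorMul`). Lemma 3.12 (L1081, p0010:L51) → `BI2017_lem_3_12` **proved**. Rem. 3.13 (semistandard `P_T` span the invariants, L1100) → `BI2017_rem_3_13` FACT
  (without the word "semistandard": all `P_β` span; weaker than printed).
§3.2 (L1114–1306, p0010–p0012):
* Thm. 3.14 (Howe; L1119) → `BI2017_thm_3_14` FACT (`m ≥ 2`, `D ≥ 1`, `0 < d`; see docstring).
  Thm. 3.15 (L1135, p0010:L97) → `BI2017_thm_3_15` FACT (`m ≥ 2`). Cor. 3.16 (L1160) →
  `BI2017_cor_3_16` FACT. Cor. 3.17 (L1170) → `BI2017_cor_3_17` FACT.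
* Thm. 3.18 (L1195, p0011:L35) → **proved**: (1) `BI2017_thm_3_18_1` (from `arrOf_linSubst` +
  `hyperdet_tensorMul`), (2) `hyperdet_eq_zero_of_odd`, `cayleyP_eq_zero_of_odd`,
  `BI2017_thm_3_18_2_powerSum` (`P_{D,m}(X_1^D+⋯+X_m^D) = m!`), `BI2017_thm_3_18_2`.
* Lemma 3.19 (L1232) → `BI2017_lem_3_19` FACT. Problem 3.20 (complexity of evaluating `P_{D,m}`) —
  not a mathematical statement, not typed.
* Thm. 3.21 (Howe, odd; L1251) → `BI2017_thm_3_21` FACT. `P_D` of eq. (3.7) (L1261) →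
  `cyclicTableau`, `oddCayleyP`. Thm. 3.22 (L1266) → `BI2017_thm_3_22` FACT (part 2) with part 1
  **proved** (`BI2017_thm_3_22_1`, the case `β = cyclicTableau D` of Thm. 3.11). Problem 3.23 —
  open question, not typed.
§3.3 (L1309–1558, p0012–p0014):
* Prop. 3.24 (L1315, p0012:L28) → `BI2017_prop_3_24` FACT (`m ≥ 2`). Prop. 3.25 (L1411, p0013:L26;
  Kumar, Kumar–Landsberg) → `BI2017_prop_3_25` FACT, Alon–Tarsi for `m` rendered as
  `Kumar2015.latinColCount m ≠ 0` (`KumarLatinRectangles.lean`). Rem. 3.26 Latin annuli (L1439) →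
  `IsLatinAnnulus`, `latinAnnulusCount`, `BI2017_rem_3_26` FACT (incl. the verified cases
  `m = 1, 3, 5, 7`, a computer calculation in the source). Rem. 3.27 (L1464) and "`e(det_n) ≥ n²`
  with equality iff `P_{n,n²}(det_n) ≠ 0`" (L1459) → `BI2017_minimalDegree_det_per` FACT.
* admissible `n`-tables (L1478–1499) → `IsAdmissibleTable`, `tableRowSign`, `tableColSign`,
  `admissibleTableCount`, `admissibleTableColCount`; Prop. 3.28 (L1501, p0013:L112) →
  `BI2017_prop_3_28` FACT with the normalisation `(n!)^{n²}` made explicit (the paper's tensor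
  `det_n` carries the factor `1/n!`, L1520); "`P_{4,16}(det_4)`, `P_{4,16}(per_4) ≠ 0` by computer"
  (L1533) → `BI2017_P416_det_per` FACT (computation).
* Cor. 3.29 (L1538, p0014:L28) → `BI2017_cor_3_29` FACT (non-normality of the orbit closures of
  `X_1⋯X_m` (`m > 2`), `det_n`, `per_n` (`n > 2`), as `¬ IsIntegrallyClosed (OrbitCoordRing _ _)`).

§6 (proofs, L2505–2862): Lemma 6.1 (affine curves with dense `ℂ^×`-orbit), Lemma 6.2, Rem. 6.4,
Lemma 6.5 concern the GIT quotient `π : \overline{Gw} → \overline{Gw} // SL_m` and are not typed (no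
GIT quotient in the tree); the elementary core of Lemma 6.3 ("`t w ∈ SL_m w` iff
`t^{b(w)} = 1`", L2664) → `BI2017_lem_6_3_core`, **proved** (`BI2017_lem_6_3_core_holds`, with
`stabilizerDetImage_eq_rootsOfUnity` = "`det(stab(w)) = μ_{a(w)}`").
Appendix = §7 of the arXiv version (L2864–3000; the environments are numbered 7.1–7.5 there, held
text p0026): Prop. 7.1 (plethysm upper bound for odd `D`, L2871) → `typeSetCount`, `BI2017_prop_A_1`
FACT (multiplicity = the tree's `plethysmCoeffOfPartition`); Cor. 7.2 (L2897) → `BI2017_cor_A_2` FACT;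
Prop. 7.3 is "stated without proof" in the source and is NOT typed (not a published theorem);
Prop. 7.4 (binary forms, L2925) → `BI2017_prop_A_4` FACT; Prop. 7.5 (ternary forms, L2976) →
`BI2017_prop_A_5` FACT (numeric/generic content; the group isomorphisms, printed modulo scalars,
are quoted in the docstrings only). Declaration names keep the suffix `A_n` (`A` = Appendix,
`n` = the number within §7). The tensor part (§4–§5) is the sibling file
`BI17FundamentalInvariantTensors.lean`.

Degenerate parameters. Several printed statements fail verbatim for `m = 1` (where `SL_1` is
trivial and every polynomial function is invariant) or `D = 0`; the corresponding facts carry the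
hypotheses `2 ≤ m` / `2 ≤ D` / `0 < D` with a note — these are additions to the printed hypotheses
inside the paper's standing conventions (forms of degree `D ≥ 2` in `m` variables), never
strengthenings.

Erratum A21 (val-lit PRINT-ERRATA row A21, lead-bip ruling 2026-08-26T13:25:59Z; print-side,
literature-certified, no kernel certificate). AS PRINTED, Thm. 2.3 lists `a'(4,3) = 2` among the
exceptions and App. Prop. 7.5(2) asserts "for a generic `w ∈ Sym⁴ℂ³` we have `stab(w) ≃ C_2`. Hence
`a'(4,3) = 2`". AS CORRECTED: for EVERY ternary quartic `stab(w) ⊇ μ₄·I`, so `a(w) ≥ 4`, and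
`a'(w) = 2` would force a linear automorphism of order `8` in `det`, i.e. a non-trivial
automorphism of the plane quartic `{w = 0}`; the generic plane quartic has trivial (linear)
automorphism group [Poonen 2005, Thm. 3/4; Huybrechts 2023, Thm. 3.15; Chang 1978; Katz–Sarnak
10.6.18], hence generically `stab(w) = μ₄·I`, `a(4,3) = 4`, `a'(4,3) = 1`, and the corrected
reading of Thm. 2.3 is "`a'(D,m) = 1` except `a'(3,2) = a'(3,3) = 2`". The typed Props
`BI2017_thm_2_3_period` (its `(D = 4 ∧ m = 3)` disjunct) and `BI2017_prop_A_5` (conjunct 2) record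
the PRINTED sentences verbatim and are therefore false-by-literature: DO NOT CONSUME them (they have
no consumer in the tree; Cor. 3.17(2) only uses `a'(D,m) = 1` as a hypothesis); their bodies are
deliberately left unchanged and no corrected variant is typed.

## References

* [BurgisserIkenmeyer2017] P. Bürgisser, C. Ikenmeyer, *Fundamental invariants of orbit closures*,
  J. Algebra 477 (2017) 390–434; arXiv:1511.02927, §2–§3.
* R. Howe, *(GL_n, GL_m)-duality and symmetric plethysm*, Proc. Indian Acad. Sci. 97 (1987) (BI
  Thms. 3.14, 3.21).
* A. Cayley, *On the theory of determinants*, Trans. Cambridge Phil. Soc. 8 (1843) (`P_{D,m}`).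
* S. Kumar, *A study of the representations supported by the orbit closure of the determinant*,
  Compositio Math. 151 (2015) [Kumar2015] (BI Prop. 3.25).
-/

noncomputable section

open MvPolynomial

namespace Literature.Computability.AlgebraicComplexity

/-! ### §2.1 Stabilizer and stabilizer period of forms -/

section StabilizerPeriod

variable {σ k : Type*} [Fintype σ] [DecidableEq σ] [Field k]

/-- The image `H = det(stab(w)) ≤ k^×` of the stabilizer of `f` under the determinant
homomorphism `det : GL_m → ℂ^×` (BI 2017 §2.1, main.tex L430: "The image `H` of `stab(w)` under the
determinant homomorphism … is a closed subgroup of `ℂ^×`"). [cite: BurgisserIkenmeyer2017, §2.1] -/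
def stabilizerDetImage (f : MvPolynomial σ k) : Subgroup kˣ :=
  (linStabilizer f).map Matrix.GeneralLinearGroup.det

/-- Membership in `det(stab(w))`, unfolded. [cite: BurgisserIkenmeyer2017, §2.1] -/
theorem mem_stabilizerDetImage_iff (f : MvPolynomial σ k) (u : kˣ) :
    u ∈ stabilizerDetImage f ↔ ∃ γ ∈ linStabilizer f, Matrix.GeneralLinearGroup.det γ = u :=
  Subgroup.mem_map

/-- The **stabilizer period** `a(w)`: "the order of `H` if `H` is finite and `a(w) := ∞` otherwise"
(BI 2017 §2.1, L436; Def. 2.2). Rendered as `Nat.card H`, so that the printed value `∞` is encoded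
by `0` (Mathlib's convention for `Nat.card` of an infinite type, as for `orderOf`); "`a(w) < ∞`" reads
`stabilizerPeriod f ≠ 0`. [cite: BurgisserIkenmeyer2017, Def. 2.2] -/
def stabilizerPeriod (f : MvPolynomial σ k) : ℕ :=
  Nat.card (stabilizerDetImage f)

/-- Unfolding lemma for `stabilizerPeriod`. [cite: BurgisserIkenmeyer2017, Def. 2.2] -/
theorem stabilizerPeriod_def (f : MvPolynomial σ k) :
    stabilizerPeriod f = Nat.card (stabilizerDetImage f) :=
  rfl

/-- The **reduced stabilizer period** `a'(w) := a(w) gcd(D,m) / D` of a form `w ∈ Sym^D k^σ`,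
`m = |σ|` (BI 2017 Def. 2.2, L451, p0006:L36; an integer by Lemma 2.1). [cite: BurgisserIkenmeyer2017, Def. 2.2] -/
def reducedStabilizerPeriod (D : ℕ) (f : MvPolynomial σ k) : ℕ :=
  stabilizerPeriod f * Nat.gcd D (Fintype.card σ) / D

/-- "`w` has a trivial stabilizer": `stab(w) = {ζ I_m | ζ^D = 1}` (BI 2017 §2.1, L428). Rendered as
the inclusion `⊆` (the scalar matrices `ζ I` with `ζ^D = 1` always stabilize a form of degree `D`).
[cite: BurgisserIkenmeyer2017, §2.1] -/
def HasTrivialStabilizer (D : ℕ) (f : MvPolynomial σ k) : Prop :=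
  ∀ γ ∈ linStabilizer f, ∃ ζ : k, ζ ^ D = 1 ∧ (γ : Matrix σ σ k) = ζ • (1 : Matrix σ σ k)

/-- "Almost all `w ∈ Sym^D k^σ` satisfy `P`" (Zariski-generic forms; BI 2017 §2.1, L459 "almost all
`w ∈ Sym^D ℂ^m` have the stabilizer period `a(D,m)`", Prop. 2.10 "almost all `w` are polystable"):
there is a nonzero polynomial function `F` on `Sym^D` (in the degree-`D` coefficients) such that
every form `f` of degree `D` with `F(f) ≠ 0` satisfies `P`. [cite: BurgisserIkenmeyer2017, §2.1] -/
def IsZariskiGeneric (D : ℕ) (P : MvPolynomial σ k → Prop) : Prop :=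
  ∃ F : MvPolynomial (DegIdx σ D) k, F ≠ 0 ∧
    ∀ f : MvPolynomial σ k, f.IsHomogeneous D → aeval (formCoeff D f) F ≠ 0 → P f

end StabilizerPeriod

/-! ### Lemma 2.1: `D / gcd(D,m)` divides the stabilizer period -/

section LemmaTwoOne

/-- **BI 2017, Lemma 2.1** (`\label{le:reduced-period}`, L439, p0006:L25): "The stabilizer period `a(w)` is a multiple of
`D / gcd(D,m)` if `a(w) < ∞`" — for a form `w` of degree `D ≥ 1` in `m` variables over `ℂ`. Printed
proof, followed here: `H = det(stab(w))` contains `{ζ^m | ζ^D = 1}` (the scalar matrices `ζ I_m`,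
`ζ^D = 1`, stabilize `w`), a cyclic group of order `D' = D / gcd(D,m)`; hence `D' ∣ |H|`. In the
`Nat.card` encoding the finiteness hypothesis is not needed (`D' ∣ 0`). [cite: BurgisserIkenmeyer2017, Lemma 2.1] -/
theorem BI2017_lem_2_1 {m D : ℕ} {f : MvPolynomial (Fin m) ℂ} (hf : f.IsHomogeneous D)
    (hD : 0 < D) : D / Nat.gcd D m ∣ stabilizerPeriod f := by
  classical
  by_cases hm : m = 0
  · subst hm
    rw [Nat.gcd_zero_right, Nat.div_self hD]
    exact one_dvd _
  -- the primitive `D`-th root of unity and the scalar matrix `ζ I`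
  set ζ : ℂ := Complex.exp (2 * Real.pi * Complex.I / D) with hζdef
  have hζ : IsPrimitiveRoot ζ D := Complex.isPrimitiveRoot_exp D hD.ne'
  have hζ0 : ζ ≠ 0 := hζ.ne_zero hD.ne'
  have hdet : Matrix.det (ζ • (1 : Matrix (Fin m) (Fin m) ℂ)) = ζ ^ m := by
    rw [Matrix.det_smul, Matrix.det_one, mul_one, Fintype.card_fin]
  have hdet0 : Matrix.det (ζ • (1 : Matrix (Fin m) (Fin m) ℂ)) ≠ 0 := by
    rw [hdet]; exact pow_ne_zero _ hζ0
  let γ : GL (Fin m) ℂ := Matrix.GeneralLinearGroup.mkOfDetNeZero _ hdet0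
  have hγ : γ ∈ linStabilizer f := by
    rw [mem_linStabilizer, linSubstRep_apply]
    change linSubst (Fin m) ℂ (ζ • (1 : Matrix (Fin m) (Fin m) ℂ)) f = f
    rw [linSubst_smul_of_isHomogeneous hf, linSubst_one, AlgHom.id_apply, hζ.pow_eq_one, one_smul]
  -- its determinant `ζ^m` lies in `H` and has order `D / gcd(D, m)`
  have hu : Matrix.GeneralLinearGroup.det γ ∈ stabilizerDetImage f :=
    Subgroup.mem_map_of_mem _ hγ
  have hval : ((Matrix.GeneralLinearGroup.det γ : ℂˣ) : ℂ) = ζ ^ m := by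
    rw [Matrix.GeneralLinearGroup.val_det_apply]
    exact hdet
  have hord : orderOf (Matrix.GeneralLinearGroup.det γ) = D / Nat.gcd D m := by
    rw [← orderOf_units, hval, orderOf_pow' ζ hm, ← hζ.eq_orderOf]
  rw [stabilizerPeriod, ← hord]
  exact Subgroup.orderOf_dvd_natCard _ hu

end LemmaTwoOne

/-! ### §2.1 Theorems 2.3–2.6 (generic periods; product of variables, power sums, `det_n`, `per_n`) -/

section PeriodFacts

/-- **Matsumura–Monsky 1963 as quoted in BI 2017 §2.1** (L466–468): "Matsumura and Monsky showed
that if `D > 2` and `m > 3`, then almost all `w ∈ Sym^D ℂ^m` have a trivial stabilizer, which implies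
`a'(D,m) = 1`." [cite: BurgisserIkenmeyer2017, §2.1 (before Thm. 2.3)] -/
def BI2017_matsumuraMonsky_trivialStabilizer : Prop :=
  ∀ (D m : ℕ), 2 < D → 3 < m →
    IsZariskiGeneric D (HasTrivialStabilizer D : MvPolynomial (Fin m) ℂ → Prop)

/-- **BI 2017, Thm. 2.3, first sentence** (`\label{th:aDm}`, L473, p0006:L56): "Let `D > 2` and `m ≥ 1`. The set of
`w ∈ Sym^D ℂ^m` with finite stabilizer is a nonempty open subset of `W`" (`W = Sym^D ℂ^m`; proof
indicated in the Appendix, after Matsumura–Monsky 1963). Rendered: the finite-stabilizer locus is the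
complement of the common zero set of a set `S` of polynomial functions on `Sym^D`, and is nonempty.
[cite: BurgisserIkenmeyer2017, Thm. 2.3] -/
def BI2017_thm_2_3_open : Prop :=
  ∀ (D m : ℕ), 2 < D → 1 ≤ m →
    (∃ S : Set (MvPolynomial (DegIdx (Fin m) D) ℂ),
      ∀ f : MvPolynomial (Fin m) ℂ, f.IsHomogeneous D →
        (Finite (linStabilizer f) ↔ ∃ F ∈ S, aeval (formCoeff D f) F ≠ 0)) ∧
    ∃ f : MvPolynomial (Fin m) ℂ, f.IsHomogeneous D ∧ Finite (linStabilizer f)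

/-- **BI 2017, Thm. 2.3, second sentence** (`\label{th:aDm}`, L473, p0006:L56): "We have `a'(D,m) = 1` except in the
following cases: `a'(3,2) = 2`, `a'(3,3) = 2`, `a'(4,3) = 2`" (`D > 2`, `m ≥ 1`; `a'(D,m)` = the
reduced stabilizer period of almost all `w ∈ Sym^D ℂ^m`, L461–466).
⚠ A21: the case `(D,m) = (4,3)` is CONTRADICTED AS PRINTED — generic plane quartics have trivial
linear automorphism group [Poonen 2005, Thm. 3/4; Huybrechts 2023, Thm. 3.15; Chang 1978;
Katz–Sarnak 10.6.18], so `stab(w) = μ₄·I` generically, `a(4,3) = 4` and `a'(4,3) = 1`; corrected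
reading of Thm. 2.3: `a'(D,m) = 1` except `a'(3,2) = a'(3,3) = 2`. DO NOT CONSUME this Prop (typed
verbatim from the print, false-by-literature on the `(D = 4 ∧ m = 3)` disjunct); no safe variant is
typed (no consumer). See the module docstring, "Erratum A21". [cite: BurgisserIkenmeyer2017, Thm. 2.3] -/
def BI2017_thm_2_3_period : Prop :=
  ∀ (D m : ℕ), 2 < D → 1 ≤ m →
    IsZariskiGeneric D fun f : MvPolynomial (Fin m) ℂ =>
      reducedStabilizerPeriod D f =
        if (D = 3 ∧ m = 2) ∨ (D = 3 ∧ m = 3) ∨ (D = 4 ∧ m = 3) then 2 else 1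

/-- **BI 2017, remark after Thm. 2.3** (L482–486): for quadratic forms (`D = 2`) the orbit of
`X_1² + ⋯ + X_m²` is dense, its stabilizer is the complex orthogonal group, and "We have
`a(2,m) = 2`": almost all quadratic forms in `m ≥ 1` variables have stabilizer period `2`.
[cite: BurgisserIkenmeyer2017, §2.1 (remark after Thm. 2.3)] -/
def BI2017_rem_quadratic_period : Prop :=
  ∀ m : ℕ, 1 ≤ m → IsZariskiGeneric 2 fun f : MvPolynomial (Fin m) ℂ => stabilizerPeriod f = 2

/-- **BI 2017, Prop. 2.4(1)** (`\label{pro:stab-X1-Xn-PS}`, L494, p0006:L76; "well-known"): "The stabilizer of `X_1⋯X_m` is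
generated by the permutation matrices and the diagonal matrices with determinant one. The stabilizer
period of `X_1⋯X_m` equals `2` if `m ≥ 2`." (`X_1⋯X_m` is the tree's `chowMonomial ℂ m`,
`NotViaSaturationsChow.lean`, written out here.) [cite: BurgisserIkenmeyer2017, Prop. 2.4(1)] -/
def BI2017_prop_2_4_1 : Prop :=
  ∀ m : ℕ,
    linStabilizer (∏ i : Fin m, X i : MvPolynomial (Fin m) ℂ) =
      Subgroup.closure
        ({γ : GL (Fin m) ℂ | ∃ π : Equiv.Perm (Fin m), (γ : Matrix (Fin m) (Fin m) ℂ) = π.permMatrix ℂ} ∪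
         {γ : GL (Fin m) ℂ | ∃ d : Fin m → ℂ, (γ : Matrix (Fin m) (Fin m) ℂ) = Matrix.diagonal d ∧
            ∏ i, d i = 1}) ∧
    (2 ≤ m → stabilizerPeriod (∏ i : Fin m, X i : MvPolynomial (Fin m) ℂ) = 2)

/-- **BI 2017, Prop. 2.4(2)** (`\label{pro:stab-X1-Xn-PS}`, L500, p0006:L76; cf. Chen–Kayal–Wigderson 2010, Ch. 2): "Suppose
`D > 2` and `m > 1`. The stabilizer of the power sum `X_1^D + ⋯ + X_m^D` is the subgroup generated by
the permutation matrices and the diagonal matrices `diag(t_1,…,t_m)`, where `t_1^D = ⋯ = t_m^D = 1`.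
The stabilizer period of `X_1^D + ⋯ + X_m^D` equals `D` if `D` is even and `2D` if `D` is odd."
[cite: BurgisserIkenmeyer2017, Prop. 2.4(2)] -/
def BI2017_prop_2_4_2 : Prop :=
  ∀ (D m : ℕ), 2 < D → 1 < m →
    linStabilizer (∑ i : Fin m, X i ^ D : MvPolynomial (Fin m) ℂ) =
      Subgroup.closure
        ({γ : GL (Fin m) ℂ | ∃ π : Equiv.Perm (Fin m), (γ : Matrix (Fin m) (Fin m) ℂ) = π.permMatrix ℂ} ∪
         {γ : GL (Fin m) ℂ | ∃ t : Fin m → ℂ, (γ : Matrix (Fin m) (Fin m) ℂ) = Matrix.diagonal t ∧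
            ∀ i, t i ^ D = 1}) ∧
    stabilizerPeriod (∑ i : Fin m, X i ^ D : MvPolynomial (Fin m) ℂ) = if Even D then D else 2 * D

/-- **BI 2017, Thm. 2.5 (Frobenius), the period** (`\label{th:stab-det}`, L513, p0006:L93): "The stabilizer period of
`det_n` equals `1` if `n mod 4 ∈ {0,1}` and … equals `2` if `n mod 4 ∈ {2,3}`" (from
`det g_{A,B} = det(A)^n det(B)^n = 1` for `A, B ∈ SL_n` and `det(τ) = (-1)^{n(n-1)/2}` for the
transposition `τ`). The first sentence of Thm. 2.5 (the stabilizer of `det_n` is generated by `τ` and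
the `g_{A,B}`, `A, B ∈ SL_n`; Frobenius 1897, Dieudonné 1949) is the tree's
`Literature.NumberTheory.DiophantineGeometry.frobenius_detPreserver_unimodular_sandwich`
(`DetStabilizerFrobenius.lean`, proved in `DetStabilizerFrobeniusProofs.lean`) and is not restated.
[cite: BurgisserIkenmeyer2017, Thm. 2.5] -/
def BI2017_thm_2_5_period : Prop :=
  ∀ n : ℕ, stabilizerPeriod (detPoly (Fin n) ℂ) = if n % 4 = 0 ∨ n % 4 = 1 then 1 else 2

/-- **BI 2017, Thm. 2.6 (Marcus and May), the period** (`\label{th:stab-per}`, L530, p0006:L109): "Let `n > 2`. … The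
stabilizer period of `per_n` equals `2` unless `n mod 4 = 0`, in which case the stabilizer period
equals `1`." The first sentence (the stabilizer of `per_n` is generated by `τ` and the `g_{A,B}` with
`A`, `B` products of a permutation matrix with a diagonal matrix of determinant `1`; Marcus–May 1962)
is the tree's `marcusMay1962_perPreserver_sandwich` (`PerStabilizerMarcusMay.lean`, proved in
`PerStabilizerMarcusMayProofs.lean`) and is not restated. [cite: BurgisserIkenmeyer2017, Thm. 2.6] -/
def BI2017_thm_2_6_period : Prop :=
  ∀ n : ℕ, 2 < n → stabilizerPeriod (perPoly (Fin n) ℂ) = if n % 4 = 0 then 1 else 2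

end PeriodFacts

/-! ### §2.2 Polystability of forms -/

section PolystabilityFacts

/-- **BI 2017, Prop. 2.8** (`\label{pro:stab-crit-forms}`, L565, p0006:L140; Hilbert–Mumford as refined by Luna 1975 / Kempf 1978),
in the special case of a DIAGONAL subgroup `R`: "Let the form `w ∈ Sym^D ℂ^m` satisfy the following
two properties: 1. There is a reductive subgroup `R` of `SL_m ∩ stab(w)` such that the centralizer of
`R` in `SL_m` is contained in the group of diagonal matrices. 2. The convex cone generated by
`supp(w)` contains `(1,…,1)`. Then `w` is polystable." Here `R ≤ SL_m` consists of diagonal matrices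
stabilizing `w` (a subgroup of the diagonal torus; its Zariski closure is diagonalizable, hence
reductive, with the same centralizer — the case of every application in the paper, Cor. 2.9), and
condition 2 reads: `(1,…,1) = ∑_{α ∈ supp(w)} c_α α` with rational `c_α ≥ 0` (`supp(w)` = exponent
vectors with nonzero coefficient, L558). -- TODO(general form): `R` an arbitrary reductive algebraic
subgroup of `SL_m ∩ stab(w)`. [cite: BurgisserIkenmeyer2017, Prop. 2.8] -/
def BI2017_prop_2_8_diag : Prop :=
  ∀ (m D : ℕ) (f : MvPolynomial (Fin m) ℂ), f.IsHomogeneous D →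
    ∀ R : Subgroup (Matrix.SpecialLinearGroup (Fin m) ℂ),
      (∀ r ∈ R, (r : Matrix (Fin m) (Fin m) ℂ).IsDiag ∧
        linSubst (Fin m) ℂ (r : Matrix (Fin m) (Fin m) ℂ) f = f) →
      (∀ g : Matrix.SpecialLinearGroup (Fin m) ℂ, (∀ r ∈ R, g * r = r * g) →
        (g : Matrix (Fin m) (Fin m) ℂ).IsDiag) →
      (∃ c : (Fin m →₀ ℕ) → ℚ, (∀ α, 0 ≤ c α) ∧
        ∀ i : Fin m, ∑ α ∈ f.support, c α * (α i : ℚ) = 1) →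
      IsPolystable f

/-- **BI 2017, Cor. 2.9, the clauses not yet in the tree** (`\label{cor:stable-forms}`, L611, p0007:L39): "The forms `X_1⋯X_m`,
`X_1^D + ⋯ + X_m^D` if `D > 1`, `det_n`, and `per_n` are all polystable." The `det_n`/`per_n` clauses
are `BurgisserIkenmeyer2017_polystable_det_per` (`Polystability.lean`; PROVED in
`PolystabilityProofs.lean`); this is the remaining pair. Printed proof: Prop. 2.8 with `R` the
diagonal torus of `SL_m`, resp. the diagonal matrices with `D`-th roots of unity.
[cite: BurgisserIkenmeyer2017, Cor. 2.9] -/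
def BI2017_cor_2_9_chow_powerSum : Prop :=
  (∀ m : ℕ, IsPolystable (∏ i : Fin m, X i : MvPolynomial (Fin m) ℂ)) ∧
  ∀ (m D : ℕ), 1 < D → IsPolystable (∑ i : Fin m, X i ^ D : MvPolynomial (Fin m) ℂ)

/-- **BI 2017, Prop. 2.10** (`\label{pro:gen-form-stable}`, L633, p0007:L60): "If `D > 1`, then almost all `w ∈ Sym^D ℂ^m` are
polystable." (`D = 2`: all `SL_m`-orbits in `Sym² ℂ^m` are closed; `D > 2`: Thm. 2.3 + Luna 1973.)
[cite: BurgisserIkenmeyer2017, Prop. 2.10] -/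
def BI2017_prop_2_10 : Prop :=
  ∀ (D m : ℕ), 1 < D → IsZariskiGeneric D (IsPolystable : MvPolynomial (Fin m) ℂ → Prop)

/-- **BI 2017, Prop. 2.11** (`\label{pro:polystab-period}`, L655, p0007:L81): "A polystable nonzero form has a finite stabilizer
period." Typed for forms of degree `D ≥ 1` (the paper's forms; for `D = 0` a nonzero constant is
polystable with stabilizer `GL_m`, so the sentence is false verbatim there — the printed proof uses
`ι(t) w = t^D w → ` unbounded). "finite" = `stabilizerPeriod f ≠ 0` in the `Nat.card` encoding.
[cite: BurgisserIkenmeyer2017, Prop. 2.11] -/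
def BI2017_prop_2_11 : Prop :=
  ∀ (m D : ℕ) (f : MvPolynomial (Fin m) ℂ), 0 < D → f.IsHomogeneous D → f ≠ 0 → IsPolystable f →
    stabilizerPeriod f ≠ 0

end PolystabilityFacts

/-! ### §3 Degree period, `SL`-invariants on `Sym^D`, degree monoid, exponent monoid -/

section DegreeMonoid

variable {σ k : Type*} [Fintype σ] [DecidableEq σ] [Field k]

/-- The **degree period** `b(w) := (m/D) a(w)` of a form `w ∈ Sym^D k^σ`, `m = |σ|` (BI 2017
Def. 3.1, L713, p0008:L10; an integer: `b(w) = a'(w) m / gcd(D,m)`, L719). [cite: BurgisserIkenmeyer2017, Def. 3.1] -/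
def degreePeriod (D : ℕ) (f : MvPolynomial σ k) : ℕ :=
  Fintype.card σ * stabilizerPeriod f / D

/-- A polynomial function `F ∈ k[Sym^D]` is `SL`-invariant: fixed by every `g ∈ SL σ k` under the
action `coordRep` on the coordinate ring of `Sym^D` (`(g·F)(v) = F(g⁻¹ v)`). These are the elements of
the invariant ring `O(Sym^D ℂ^m)^{SL_m}` of BI 2017 §3 (L709); the companion predicate
`IsSLInvariantOnForms` (`PencilFamily.lean`) is the same notion in the all-monomial coordinates
`σ →₀ ℕ`. [cite: BurgisserIkenmeyer2017, §3] -/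
def IsSLInvariantCoord (D : ℕ) (F : MvPolynomial (DegIdx σ D) k) : Prop :=
  ∀ g : Matrix.SpecialLinearGroup σ k, coordRep σ k D (Matrix.SpecialLinearGroup.toGL g) F = F

/-- The `SL`-invariant polynomial functions on `Sym^D` form a submodule (indeed a subalgebra): the
invariants of the restriction of `coordRep` to `SL`. BI 2017 §3, `O(Sym^D ℂ^m)^{SL_m}`.
[cite: BurgisserIkenmeyer2017, §3] -/
def slInvariantSubmodule (σ k : Type*) [Fintype σ] [DecidableEq σ] [Field k] (D : ℕ) :
    Submodule k (MvPolynomial (DegIdx σ D) k) where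
  carrier := {F | IsSLInvariantCoord D F}
  add_mem' {F G} hF hG := fun g => by rw [map_add, hF g, hG g]
  zero_mem' := fun g => map_zero _
  smul_mem' c {F} hF := fun g => by
    change coordRep σ k D _ (c • F) = c • F
    rw [map_smul, hF g]

/-- Membership in `slInvariantSubmodule` is `IsSLInvariantCoord`. [cite: BurgisserIkenmeyer2017, §3] -/
theorem mem_slInvariantSubmodule_iff (D : ℕ) (F : MvPolynomial (DegIdx σ D) k) :
    F ∈ slInvariantSubmodule σ k D ↔ IsSLInvariantCoord D F :=
  Iff.rfl

/-- Pulling a polynomial function in the degree-`D` coefficients back to the all-monomial coordinates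
`σ →₀ ℕ` of `coeffVec` (`OrbitClosure.lean`) does not change its values at polynomials.
[cite: BurgisserIkenmeyer2017, §3] -/
theorem aeval_coeffVec_rename_val (D : ℕ) (f : MvPolynomial σ k) (F : MvPolynomial (DegIdx σ D) k) :
    aeval (coeffVec f) (rename (fun e : DegIdx σ D => (e : σ →₀ ℕ)) F) = aeval (formCoeff D f) F := by
  rw [aeval_rename]
  rfl

/-- An invariant polynomial function takes the same value at `w` and at `g · w`, `g ∈ SL`
(`(g · F)(w) = F(g⁻¹ w)`, `aeval_formCoeff_coordSubst`). [cite: BurgisserIkenmeyer2017, §3] -/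
theorem IsSLInvariantCoord.aeval_formCoeff_linSubst {D : ℕ} {F : MvPolynomial (DegIdx σ D) k}
    (hF : IsSLInvariantCoord D F) (g : Matrix.SpecialLinearGroup σ k) (f : MvPolynomial σ k) :
    aeval (formCoeff D (linSubst σ k (g : Matrix σ σ k) f)) F = aeval (formCoeff D f) F := by
  have h1 : coordSubst D (Matrix.SpecialLinearGroup.toGL g⁻¹) F = F := by
    have := hF g⁻¹
    rwa [coordRep_apply] at this
  have h2 := aeval_formCoeff_coordSubst D (Matrix.SpecialLinearGroup.toGL g⁻¹) f F
  have h3 : (Matrix.SpecialLinearGroup.toGL g⁻¹)⁻¹ = Matrix.SpecialLinearGroup.toGL g := by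
    rw [map_inv, inv_inv]
  rw [h1, h3, linSubstRep_apply] at h2
  exact h2.symm

/-- **Bridge to `PencilFamily.lean`**: an `SL`-invariant in the sense of `coordRep`
(`IsSLInvariantCoord`, coordinates `DegIdx σ D`) is, after renaming its variables into the
all-monomial coordinates, an `SL`-invariant on forms of degree `D` in the sense of
`IsSLInvariantOnForms` (BI 2017 §3: both render `O(Sym^D ℂ^m)^{SL_m}`). [cite: BurgisserIkenmeyer2017, §3] -/
theorem IsSLInvariantCoord.isSLInvariantOnForms_rename {D : ℕ} {F : MvPolynomial (DegIdx σ D) k}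
    (hF : IsSLInvariantCoord D F) :
    IsSLInvariantOnForms D (rename (fun e : DegIdx σ D => (e : σ →₀ ℕ)) F) := by
  intro g f _
  rw [aeval_coeffVec_rename_val, aeval_coeffVec_rename_val]
  exact hF.aeval_formCoeff_linSubst g f

/-- The degree-`d` part `O(Sym^D)^{SL}_d` of the invariant ring: homogeneous `SL`-invariant polynomial
functions of degree `d` on `Sym^D` (BI 2017 §3, L709–711). [cite: BurgisserIkenmeyer2017, §3] -/
def slInvariantsOfDegree (σ k : Type*) [Fintype σ] [DecidableEq σ] [Field k] (D d : ℕ) :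
    Submodule k (MvPolynomial (DegIdx σ D) k) :=
  homogeneousSubmodule (DegIdx σ D) k d ⊓ slInvariantSubmodule σ k D

/-- Membership in `O(Sym^D)^{SL}_d`. [cite: BurgisserIkenmeyer2017, §3] -/
theorem mem_slInvariantsOfDegree_iff (D d : ℕ) (F : MvPolynomial (DegIdx σ D) k) :
    F ∈ slInvariantsOfDegree σ k D d ↔ F.IsHomogeneous d ∧ IsSLInvariantCoord D F := by
  rw [slInvariantsOfDegree, Submodule.mem_inf, mem_homogeneousSubmodule, mem_slInvariantSubmodule_iff]

/-- The **degree monoid** `E(w) := {d ∈ ℕ | O(\overline{Gw})^{SL_m}_d ≠ 0}` of a form `w` of degree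
`D` (BI 2017 Def. 3.3, L772, p0008:L68): the degrees `d` in which some homogeneous `SL`-invariant
polynomial function on `Sym^D` does not vanish identically on the orbit `GL · w` (equivalently, is
nonzero in `O(\overline{Gw}) = k[Sym^D] ⧸ I(GL · w)`; see the module docstring for the identification
with the printed `O(\overline{Gw})^{SL_m}_d`). [cite: BurgisserIkenmeyer2017, Def. 3.3] -/
def degreeMonoid (D : ℕ) (f : MvPolynomial σ k) : Set ℕ :=
  {d | ∃ F : MvPolynomial (DegIdx σ D) k,
    F.IsHomogeneous d ∧ IsSLInvariantCoord D F ∧ F ∉ orbitVanishingIdeal f D}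

/-- The **minimal degree** `e(w)`: "the minimal positive element of `E(w)`" (BI 2017 Def. 3.3, L778;
junk value `0` if there is none). [cite: BurgisserIkenmeyer2017, Def. 3.3] -/
def minimalDegree (D : ℕ) (f : MvPolynomial σ k) : ℕ :=
  sInf {d | d ∈ degreeMonoid D f ∧ 0 < d}

/-- The **exponent monoid** `E'(w) := {k ∈ ℕ | (φ_w)^k has a regular extension to \overline{Gw}}`,
where `φ_w : Gw → ℂ, g w ↦ det(g)^{a(w)}` (BI 2017 Def. 3.5, L792, p0008:L87; `φ_w` L723): `e ∈ E'(w)`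
iff some polynomial function `F` on `Sym^D` satisfies `F(g · w) = det(g)^{a(w) e}` for all `g ∈ GL`.
[cite: BurgisserIkenmeyer2017, Def. 3.5] -/
def exponentMonoid (D : ℕ) (f : MvPolynomial σ k) : Set ℕ :=
  {e | ∃ F : MvPolynomial (DegIdx σ D) k, ∀ g : GL σ k,
    aeval (formCoeff D (linSubstRep σ k g f)) F =
      ((Matrix.GeneralLinearGroup.det g : kˣ) : k) ^ (stabilizerPeriod f * e)}

/-- The **minimal exponent** `e'(w)`: the minimal positive element of `E'(w)` (BI 2017 Def. 3.5,
L797; junk `0` if none). [cite: BurgisserIkenmeyer2017, Def. 3.5] -/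
def minimalExponent (D : ℕ) (f : MvPolynomial σ k) : ℕ :=
  sInf {e | e ∈ exponentMonoid D f ∧ 0 < e}

/-- The **generic degree monoid** `E(D,m) := {d ∈ ℕ | O(Sym^D ℂ^m)^{SL_m}_d ≠ 0}` (BI 2017 Def. 3.6,
L804, p0008:L100): degrees carrying a nonzero homogeneous `SL`-invariant polynomial function on
`Sym^D k^σ`. [cite: BurgisserIkenmeyer2017, Def. 3.6] -/
def genericDegreeMonoid (σ k : Type*) [Fintype σ] [DecidableEq σ] [Field k] (D : ℕ) : Set ℕ :=
  {d | ∃ F : MvPolynomial (DegIdx σ D) k, F.IsHomogeneous d ∧ IsSLInvariantCoord D F ∧ F ≠ 0}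

/-- The **generic minimal degree** `e(D,m)`: the minimal positive element of `E(D,m)` (BI 2017
Def. 3.6, L809; junk `0` if none). [cite: BurgisserIkenmeyer2017, Def. 3.6] -/
def genericMinimalDegree (σ k : Type*) [Fintype σ] [DecidableEq σ] [Field k] (D : ℕ) : ℕ :=
  sInf {d | d ∈ genericDegreeMonoid σ k D ∧ 0 < d}

/-- `E(w) ⊆ E(D,m)`: an invariant not vanishing on the orbit is nonzero (BI 2017, proof of Thm. 3.15,
L1147: "`O(\overline{Gw})^{SL_m}_d ≠ 0` implies `O(Sym^D ℂ^m)^{SL_m}_d ≠ 0`"). [cite: BurgisserIkenmeyer2017, Thm. 3.15 (proof)] -/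
theorem degreeMonoid_subset_genericDegreeMonoid (D : ℕ) (f : MvPolynomial σ k) :
    degreeMonoid D f ⊆ genericDegreeMonoid σ k D := by
  rintro d ⟨F, hFd, hFi, hFI⟩
  refine ⟨F, hFd, hFi, ?_⟩
  rintro rfl
  exact hFI (Ideal.zero_mem _)

/-- A polynomial function `Φ` on `Sym^D` **represents the fundamental invariant** `Φ_w` of `w`: "the
`SL_m`-invariant `Φ_w ∈ O(\overline{Gw})` of the (minimal) degree `e(w)` satisfying `Φ_w(w) = 1`"
(BI 2017 Def. 3.8, L839, p0008:L137; `Φ_w` itself is the class of `Φ` in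
`OrbitCoordRing f D = k[Sym^D] ⧸ I(GL·w)`). [cite: BurgisserIkenmeyer2017, Def. 3.8] -/
def IsFundamentalInvariant (D : ℕ) (f : MvPolynomial σ k) (Φ : MvPolynomial (DegIdx σ D) k) : Prop :=
  Φ.IsHomogeneous (minimalDegree D f) ∧ IsSLInvariantCoord D Φ ∧ aeval (formCoeff D f) Φ = 1

/-- The **vanishing ideal of the boundary** `\overline{Gw} ∖ Gw` in `k[Sym^D]`: polynomial functions
vanishing at (the degree-`D` coefficient vectors of) every point of the orbit closure (`orbitClosure`,
`OrbitClosure.lean`) outside the orbit `glOrbit` (BI 2017 Thm. 3.10, L934: "the vanishing ideal of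
the boundary `\overline{Gw} ∖ Gw` in `\overline{Gw}`" is its image in `OrbitCoordRing f D`).
[cite: BurgisserIkenmeyer2017, Thm. 3.10] -/
def boundaryVanishingIdeal (D : ℕ) (f : MvPolynomial σ k) : Ideal (MvPolynomial (DegIdx σ D) k) :=
  MvPolynomial.vanishingIdeal k (formCoeff D '' (orbitClosure f \ glOrbit σ k f))

end DegreeMonoid

/-! ### Eq. (3.1): `D · b(w) = m · a(w)` -/

/-- **BI 2017, eq. (3.1)** (`\label{eq:Db=ma}`, L764): "`D b(w) = m a(w)`" for a form of degree `D ≥ 1` in `m` variables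
(`b(w) = (m/D) a(w)` is an integer because `D / gcd(D,m)` divides `a(w)`, Lemma 2.1, L719).
[cite: BurgisserIkenmeyer2017, eq. (3.1)] -/
theorem BI2017_eq_3_1 {m D : ℕ} {f : MvPolynomial (Fin m) ℂ} (hf : f.IsHomogeneous D) (hD : 0 < D) :
    D * degreePeriod D f = m * stabilizerPeriod f := by
  rw [degreePeriod, Fintype.card_fin]
  refine Nat.mul_div_cancel' ?_
  -- `D ∣ m a(w)`: write `a(w) = (D / g) c`, `g = gcd(D,m)`; then `m a = (m/g) · (g · D/g) · c = D · (m/g) c`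
  obtain ⟨c, hc⟩ := BI2017_lem_2_1 hf hD
  have hgm : Nat.gcd D m ∣ m := Nat.gcd_dvd_right D m
  have hgD : Nat.gcd D m ∣ D := Nat.gcd_dvd_left D m
  refine ⟨m / Nat.gcd D m * c, ?_⟩
  rw [hc]
  calc m * (D / Nat.gcd D m * c)
      = (m / Nat.gcd D m * Nat.gcd D m) * (D / Nat.gcd D m * c) := by rw [Nat.div_mul_cancel hgm]
    _ = m / Nat.gcd D m * (Nat.gcd D m * (D / Nat.gcd D m)) * c := by ring
    _ = m / Nat.gcd D m * D * c := by rw [Nat.mul_div_cancel' hgD]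
    _ = D * (m / Nat.gcd D m * c) := by ring

/-! ### §3 Theorems 3.4, 3.9, 3.10 and Lemma 3.2(3) (named facts) -/

section DegreeMonoidFacts

/-- **BI 2017, Lemma 3.2(3) / "`E(w) = b(w) E'(w)` and `e(w) = b(w) e'(w)`"** (L739–741, L800,
p0008:L22–L98), for a polystable nonzero form `w` of degree `D ≥ 2` in `m` variables: the degree
monoid is the exponent monoid scaled by the degree period, and likewise for the minimal elements.
(Parts (1)–(2) of Lemma 3.2 concern `φ_w` on the orbit and the coordinate ring `O(Gw)` of the
quasi-affine orbit and are not typed.) [cite: BurgisserIkenmeyer2017, Lemma 3.2(3)] -/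
def BI2017_lem_3_2_3 : Prop :=
  ∀ (m D : ℕ) (f : MvPolynomial (Fin m) ℂ), 2 ≤ D → f.IsHomogeneous D → f ≠ 0 → IsPolystable f →
    degreeMonoid D f = (fun e => degreePeriod D f * e) '' exponentMonoid D f ∧
    minimalDegree D f = degreePeriod D f * minimalExponent D f

/-- **BI 2017, Thm. 3.4** (`\label{th:group_S_w}`, L784, p0008:L81; proof in §6.2): "The degree monoid `E(w)` generates the
group `b(w)ℤ`" — for a polystable form `w` ("Throughout this section, we assume that `w ∈ Sym^D ℂ^m`
is a polystable form", L706), here nonzero of degree `D ≥ 2`. [cite: BurgisserIkenmeyer2017, Thm. 3.4] -/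
def BI2017_thm_3_4 : Prop :=
  ∀ (m D : ℕ) (f : MvPolynomial (Fin m) ℂ), 2 ≤ D → f.IsHomogeneous D → f ≠ 0 → IsPolystable f →
    AddSubgroup.closure ((fun d : ℕ => (d : ℤ)) '' degreeMonoid D f) =
      AddSubgroup.zmultiples ((degreePeriod D f : ℕ) : ℤ)

/-- **BI 2017, "`E(w) = E(D,m)`, and hence `e(w) = e(D,m)`, for almost all `w ∈ Sym^D ℂ^m`"**
(L813, "It is easy to see"). [cite: BurgisserIkenmeyer2017, §3 (after Def. 3.6)] -/
def BI2017_degreeMonoid_generic : Prop :=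
  ∀ (D m : ℕ), IsZariskiGeneric D fun f : MvPolynomial (Fin m) ℂ =>
    degreeMonoid D f = genericDegreeMonoid (Fin m) ℂ D ∧
      minimalDegree D f = genericMinimalDegree (Fin m) ℂ D

/-- **BI 2017, Example 3.7** (L823, p0008:L122; computed with the SCHUR package, resp. Fulton–Harris
p. 153 for `(2,2)`): "`E(2,2) = 2ℕ`"; "`E(3,3) = 2(ℕ ∖ {1})` and hence `e(3,3) = 4`";
"`E(4,4) = {0,4,6,7,8,10,11,…}`, so the gaps are `1,2,3,5,9` and we have `e(4,4) = 4`". (The values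
`b(2,2) = 2`, `b(3,3) = 2`, `b(4,4) = 1` of the example are instances of Thm. 2.3 / the remark
`a(2,m) = 2` and are not repeated.) [cite: BurgisserIkenmeyer2017, Ex. 3.7] -/
def BI2017_ex_3_7 : Prop :=
  genericDegreeMonoid (Fin 2) ℂ 2 = {d | Even d} ∧
  genericDegreeMonoid (Fin 3) ℂ 3 = {d | Even d ∧ d ≠ 2} ∧ genericMinimalDegree (Fin 3) ℂ 3 = 4 ∧
  genericDegreeMonoid (Fin 4) ℂ 4 = {d | d ≠ 1 ∧ d ≠ 2 ∧ d ≠ 3 ∧ d ≠ 5 ∧ d ≠ 9} ∧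
  genericMinimalDegree (Fin 4) ℂ 4 = 4

/-- **BI 2017, Prop. 3.9(1)** (`\label{le:ext-zero}`, L874, p0008:L150): "The zero set of `Φ_w` in `\overline{Gw}` equals
the boundary `\overline{Gw} ∖ Gw`" — `w ≠ 0` polystable of degree `D ≥ 2` (L836), `Φ` representing
the fundamental invariant. (Part (2), `O(Gw) = O(\overline{Gw})_{Φ_w}`, is about the coordinate ring
of the orbit and is not typed.) [cite: BurgisserIkenmeyer2017, Prop. 3.9(1)] -/
def BI2017_prop_3_9_1 : Prop :=
  ∀ (m D : ℕ) (f : MvPolynomial (Fin m) ℂ) (Φ : MvPolynomial (DegIdx (Fin m) D) ℂ),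
    2 ≤ D → f.IsHomogeneous D → f ≠ 0 → IsPolystable f → IsFundamentalInvariant D f Φ →
    ∀ v ∈ orbitClosure f, aeval (formCoeff D v) Φ = 0 ↔ v ∉ glOrbit (Fin m) ℂ f

/-- **BI 2017, Thm. 3.10** (`\label{le:Phi_w-zeroset}`, L934, p0009:L39; proof in §6.3): "If we assume that `b(w) < e(w)`, that
is, `1 < e'(w)`, then the vanishing ideal of the boundary `\overline{Gw} ∖ Gw` in `\overline{Gw}` is
strictly larger than the principal ideal `Φ_w O(\overline{Gw})`. Moreover, `\overline{Gw}` is not a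
normal algebraic variety." (`w ≠ 0` polystable of degree `D ≥ 2`; normality of the irreducible
affine variety `\overline{Gw}` = its coordinate ring `OrbitCoordRing` is integrally closed. The last
clause "In particular, `O(\overline{Gw})` is not a valuation ring" is not typed.)
[cite: BurgisserIkenmeyer2017, Thm. 3.10] -/
def BI2017_thm_3_10 : Prop :=
  ∀ (m D : ℕ) (f : MvPolynomial (Fin m) ℂ) (Φ : MvPolynomial (DegIdx (Fin m) D) ℂ),
    2 ≤ D → f.IsHomogeneous D → f ≠ 0 → IsPolystable f → IsFundamentalInvariant D f Φ →
    degreePeriod D f < minimalDegree D f →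
      Ideal.span {Ideal.Quotient.mk (orbitVanishingIdeal f D) Φ} <
          (boundaryVanishingIdeal D f).map (Ideal.Quotient.mk (orbitVanishingIdeal f D)) ∧
      ¬ IsIntegrallyClosed (OrbitCoordRing f D)

/-- **BI 2017, Lemma 6.3 (§6.2, proof of Thm. 3.4), elementary core** (`\label{le:stab-piw}`, L2664–2700): the lemma
reads "`{t ∈ ℂ^× | t p = p} = μ_{b(w)}`" for `p = π(w)` the image of `w` in the GIT quotient
`Z = X // SL_m`; its printed proof establishes (and, `SL_m w` being closed, is equivalent to) the
statement typed here: for `t ∈ ℂ^×`, `t w ∈ SL_m · w` iff `t^{b(w)} = 1` ("Since `G_s w` is closed,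
this means that `tw ∈ G_s w` … `1 = det(g_s ι(t_1))^{a(w)} = t_1^{m a(w)} = t_1^{D b(w)} = t^{b(w)}`";
conversely "`det(stab(w)) = μ_{a(w)}` … `g_s w = t_1^D w`"). For a form `w` of degree `D ≥ 1` with
finite stabilizer period (the GIT quotient `π`, Lemma 6.2 and Rem. 6.4 are not typed).
[cite: BurgisserIkenmeyer2017, Lemma 6.3] -/
def BI2017_lem_6_3_core : Prop :=
  ∀ (m D : ℕ) (f : MvPolynomial (Fin m) ℂ), 0 < D → f.IsHomogeneous D → stabilizerPeriod f ≠ 0 →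
    ∀ t : ℂ, t ≠ 0 → (t • f ∈ slOrbit (Fin m) ℂ f ↔ t ^ degreePeriod D f = 1)

end DegreeMonoidFacts

/-! ### §3.1 Constructing invariants of forms: tableau invariants `P_T`, Cayley's `P_{D,m}` -/

section Tableau

variable {R : Type*} [CommRing R] {D d m s : ℕ}

/-- The **tableau invariant** `P_T` of BI 2017 eq. (3.4) (L1007, p0009):
`P_T(v) = ∑_{σ_1,…,σ_s ∈ S_m} [∏_j sgn σ_j] ∏_{i=1}^d v(σ_{T_{1,i}}(T^{1,i}), …, σ_{T_{D,i}}(T^{D,i}))`,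
a degree-`d` polynomial function of an array `v : [m]^D → R` (`s = Dd/m`), determined by the bijection
`β : [D] × [d] → [m] × [s]`, `(ι,i) ↦ (T^{ι,i}, T_{ι,i})` = (row, column) of the `ι`-th occurrence of
the label `i` in the `m × s` tableau `T` (eq. (3.2), L974). Stated for an arbitrary bijection `β`.
[cite: BurgisserIkenmeyer2017, eq. (3.4)] -/
def tableauInv (β : Fin D × Fin d ≃ Fin m × Fin s) (v : (Fin D → Fin m) → R) : R :=
  ∑ σ : Fin s → Equiv.Perm (Fin m),
    (∏ j, (Equiv.Perm.sign (σ j) : R)) * ∏ i : Fin d, v fun ι => σ (β (ι, i)).2 (β (ι, i)).1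

/-- **`P_{D,m}` is Cayley's hyperdeterminant**: for the row tableau (all labels `i` in row `i`,
`d = m`, `s = D`; eq. (3.3)/(3.5), L958/L1018) the bijection is `(ι,i) ↦ (i,ι)` and `P_T` is literally
the tree's `hyperdet` (`Hyperdeterminant.lean`; BI: "the invariant `P_{D,m}` was already studied by
Cayley in 1843", L1023). [cite: BurgisserIkenmeyer2017, eq. (3.5)] -/
theorem tableauInv_prodComm (v : (Fin D → Fin m) → R) :
    tableauInv (Equiv.prodComm (Fin D) (Fin m)) v = hyperdet v :=
  rfl

/-- Ring homomorphisms commute with the tableau invariants `P_T` of BI 2017 eq. (3.4) (polynomial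
expressions with integer coefficients in the entries of the array). [cite: BurgisserIkenmeyer2017, eq. (3.4)] -/
theorem map_tableauInv {S : Type*} [CommRing S] (φ : R →+* S) (β : Fin D × Fin d ≃ Fin m × Fin s)
    (v : (Fin D → Fin m) → R) : φ (tableauInv β v) = tableauInv β fun J => φ (v J) := by
  unfold tableauInv
  simp [map_sum, map_mul, map_prod]

/-- The **cyclic tableau** of BI 2017 §3.2.1 (L1255: the `D × (D+1)` tableau with entry
`(j − i + 1) mod (D+1)` in row `i`, column `j`), as the bijection `(ι, i) ↦ (ι, i + ι)` (label `i`
occupies row `ι` of column `i + ι mod (D+1)`), which yields eq. (3.7):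
`P_D = ∑_{σ_1,…,σ_{D+1}} [∏ sgn σ_j] ∏_{i=1}^{D+1} v(σ_i(1), σ_{i+1}(2), …, σ_{i+D-1}(D))`, indices
mod `D+1` (L1261). [cite: BurgisserIkenmeyer2017, eq. (3.7)] -/
def cyclicTableau (D : ℕ) : Fin D × Fin (D + 1) ≃ Fin D × Fin (D + 1) where
  toFun p := (p.1, p.2 + Fin.castSucc p.1)
  invFun p := (p.1, p.2 - Fin.castSucc p.1)
  left_inv p := by simp
  right_inv p := by simp

variable {σ k : Type*} [Fintype σ] [DecidableEq σ] [Field k]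

/-- The generic symmetric array on `Sym^D` in the letters `t : [m] → σ`: `J ↦ X_{x_{t∘J}} / #{I :
x_I = x_{t∘J}}`, whose value at `formCoeff D q` is the symmetric array `arrOf D q (t ∘ J)` of the form
`q` (the array used inside `hyperdetPoly`). BI 2017 §3.1, L993 (forms as symmetric tensors
`v : [m]^D → ℂ`). [cite: BurgisserIkenmeyer2017, §3.1] -/
def symArrayPoly (D : ℕ) (t : Fin m → σ) (J : Fin D → Fin m) : MvPolynomial (DegIdx σ D) k :=
  C (((Finset.univ.filter fun I : Fin D → σ => wordExp I = wordExp (t ∘ J)).card : k)⁻¹) *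
    X (wordDegIdx t J)

/-- The tableau invariant `P_T` as a **polynomial function on `Sym^D`** (in the degree-`D`
coefficients, letters `t`): an element of `O(Sym^D ℂ^m)_d` (BI 2017 §3.1, L949 "the construction
process always returns an element `P` in `O(Sym^D ℂ^m)^{SL_m}_d`"). [cite: BurgisserIkenmeyer2017, §3.1] -/
def tableauInvPoly (D : ℕ) (β : Fin D × Fin d ≃ Fin m × Fin s) (t : Fin m → σ) :
    MvPolynomial (DegIdx σ D) k :=
  tableauInv β (symArrayPoly (k := k) D t)

/-- For the row tableau, `tableauInvPoly` is the tree's hyperdeterminant polynomial `hyperdetPoly`.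
[cite: BurgisserIkenmeyer2017, eq. (3.5)] -/
theorem tableauInvPoly_prodComm (D : ℕ) (t : Fin m → σ) :
    tableauInvPoly (k := k) D (Equiv.prodComm (Fin D) (Fin m)) t = hyperdetPoly D t :=
  rfl

/-- **Cayley's invariant / the generic fundamental invariant `P_{D,m}`** of `Sym^D k^σ` (BI 2017
eq. (3.5), L1018; §3.2 "We call `P_{D,m}` the generic fundamental invariant of `Sym^D ℂ^m`", L1130),
as a polynomial function on `Sym^D` in the degree-`D` coefficients, all `m = |σ|` variables being
letters via the enumeration `t : Fin m ≃ σ`: the tree's `hyperdetPoly D t`. [cite: BurgisserIkenmeyer2017, eq. (3.5)] -/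
abbrev cayleyP (D : ℕ) (t : Fin m ≃ σ) : MvPolynomial (DegIdx σ D) k :=
  hyperdetPoly D (t : Fin m → σ)

/-- `P_D` of BI 2017 eq. (3.7) (L1261) as a polynomial function on `Sym^D k^D` (`m = D` letters
`t`): the tableau invariant of the cyclic tableau, of degree `D + 1`. [cite: BurgisserIkenmeyer2017, eq. (3.7)] -/
abbrev oddCayleyP (D : ℕ) (t : Fin D ≃ σ) : MvPolynomial (DegIdx σ D) k :=
  tableauInvPoly D (cyclicTableau D) (t : Fin D → σ)

end Tableau

/-! ### Lemma 3.12 and Theorem 3.11 -/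

section LemmaThreeTwelve

variable {R : Type*} [CommRing R] {m : ℕ}

/-- **BI 2017, Lemma 3.12** (`\label{le:easy-cancel}`, L1081, p0010:L51): "Let `g ∈ GL_m` and `γ : [m] → [m]` be a map. Then
the sum `∑_{σ ∈ S_m} sgn(σ) ∏_{κ=1}^m g(σ(κ); γ(κ))` equals `sgn(γ) det(g)` if `γ` is a permutation and
zero otherwise." (Printed proof: the sum is `det` of the matrix `g̃(k;κ) = g(k;γ(κ))`, which has two
equal columns if `γ` is not injective.) Here for any square matrix over a commutative ring, with
"`γ` is a permutation" as `γ` bijective and `sgn(γ)` the sign of the corresponding `Equiv`.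
[cite: BurgisserIkenmeyer2017, Lemma 3.12] -/
theorem BI2017_lem_3_12 (g : Matrix (Fin m) (Fin m) R) (γ : Fin m → Fin m) :
    (∑ τ : Equiv.Perm (Fin m), (Equiv.Perm.sign τ : R) * ∏ κ, g (τ κ) (γ κ)) =
      if h : Function.Bijective γ then (Equiv.Perm.sign (Equiv.ofBijective γ h) : R) * g.det
      else 0 := by
  -- the sum is the Leibniz expansion of `det (g.submatrix id γ)`
  have hsum : (∑ τ : Equiv.Perm (Fin m), (Equiv.Perm.sign τ : R) * ∏ κ, g (τ κ) (γ κ)) =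
      (g.submatrix id γ).det := by
    rw [Matrix.det_apply']
    rfl
  rw [hsum]
  split_ifs with h
  · have : g.submatrix id γ = g.submatrix id (Equiv.ofBijective γ h) := rfl
    rw [this, Matrix.det_permute']
  · -- `γ` not injective: two equal columns
    have hinj : ¬Function.Injective γ := fun hi => h (Finite.injective_iff_bijective.mp hi)
    obtain ⟨a, b, hab, hne⟩ : ∃ a b, γ a = γ b ∧ a ≠ b := by
      by_contra hcon
      push Not at hcon
      exact hinj fun a b hab => hcon a b hab
    exact Matrix.det_zero_of_column_eq hne fun κ => by simp [Matrix.submatrix_apply, hab]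

end LemmaThreeTwelve

section TheoremThreeEleven

/-- **BI 2017, Thm. 3.11** (`\label{thm:PTnonzero}`, L1032, p0009:L146): "We have `P_T(gv) = (det g)^s P_T(v)` for all
`g ∈ GL_m` and `v ∈ ⊗^D ℂ^m`", where `(gv)(μ) = ∑_{r : [D] → [m]} v(r) ∏_ι g(μ_ι; r(ι))` (eq. (3.3),
L1038). Stated for every bijection `β : [D] × [d] ≃ [m] × [s]` and every square matrix over a
commutative ring (the printed proof — exchange of sums and Lemma 3.12 column by column — uses only
that `β` is a bijection). The case `β = Equiv.prodComm` (`P_{D,m}`, Thm. 3.18(1)) is the tree's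
`hyperdet_tensorMul` (PROVED). [cite: BurgisserIkenmeyer2017, Thm. 3.11] -/
def BI2017_thm_3_11 : Prop :=
  ∀ (R : Type) [CommRing R] (D d m s : ℕ) (β : Fin D × Fin d ≃ Fin m × Fin s)
    (g : Matrix (Fin m) (Fin m) R) (v : (Fin D → Fin m) → R),
    tableauInv β (fun I => ∑ J : Fin D → Fin m, (∏ r, g (I r) (J r)) * v J) =
      g.det ^ s * tableauInv β v

/-- **BI 2017, Rem. 3.13** (L1100, p0010:L70; cf. Ikenmeyer 2012 §3(A)): "The degree `d` invariant
space `O(Sym^D ℂ^m)_d^{SL_m}` is generated by the set of all invariants `P_T`, where `T` runs over all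
semistandard tableaux of shape `m × s` with exactly `D` entries of each number `1,…,d`." Typed in the
weaker form without "semistandard": every homogeneous `SL_m`-invariant of degree `d` (`m d = D s`-free:
if `m ∤ Dd` there is none but `0`) is a `ℂ`-linear combination of the `P_β`, `β` ranging over all
bijections `[D] × [d] ≃ [m] × [s]`. [cite: BurgisserIkenmeyer2017, Rem. 3.13] -/
def BI2017_rem_3_13 : Prop :=
  ∀ (D d m : ℕ) (F : MvPolynomial (DegIdx (Fin m) D) ℂ), 1 ≤ m → F.IsHomogeneous d →
    IsSLInvariantCoord D F →
    F ∈ Submodule.span ℂ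
      {P | ∃ (s : ℕ) (β : Fin D × Fin d ≃ Fin m × Fin s), P = tableauInvPoly D β (id : Fin m → Fin m)}

end TheoremThreeEleven

/-! ### Proof of Theorem 3.11 (invariance of the tableau invariants `P_T`) -/

section TheoremThreeElevenProof

variable {R : Type*} [CommRing R] {D d m s : ℕ}

/-- The tableau `Γ(r)` of the printed proof of Thm. 3.11 (L1063–1068): the entry of the box
`(κ, j)` is `r_{T(κ,j)}(T̃(κ,j))`, i.e. `J i ι` for `(ι, i) = β⁻¹(κ, j)`. [cite: BurgisserIkenmeyer2017, Thm. 3.11 (proof)] -/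
def tableauOfSlots (β : Fin D × Fin d ≃ Fin m × Fin s) (J : Fin d → Fin D → Fin m)
    (j : Fin s) (κ : Fin m) : Fin m :=
  J (β.symm (κ, j)).2 (β.symm (κ, j)).1

/-- **BI 2017, Thm. 3.11, PROVED** (`\label{thm:PTnonzero}`, L1032–1079), following the printed
proof: expand `P_T(gv)` by multilinearity into a sum over slot assignments `r = (r_1,…,r_d)`,
regroup the `g`-factors box by box through the bijection `β` (eq. (3.3), L989), factor the sum over
`(σ_1,…,σ_s)` column by column, and apply Lemma 3.12 to each column: the term survives only when
every column of `Γ(r)` is a permutation, in which case it equals `det(g)^s ∏_j sgn(γ_j)` times the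
corresponding term of `P_T(v)`. Universe-polymorphic form; `BI2017_thm_3_11_holds` below is the
named statement. [cite: BurgisserIkenmeyer2017, Thm. 3.11] -/
theorem tableauInv_tensorMul (β : Fin D × Fin d ≃ Fin m × Fin s) (g : Matrix (Fin m) (Fin m) R)
    (v : (Fin D → Fin m) → R) :
    tableauInv β (fun I => ∑ J : Fin D → Fin m, (∏ r, g (I r) (J r)) * v J) =
      g.det ^ s * tableauInv β v := by
  classical
  unfold tableauInv
  -- Step 1: multilinear expansion `∏_i ∑_{J_i} c(J_i) = ∑_J ∏_i c(J i)`
  have step1 : ∀ σ : Fin s → Equiv.Perm (Fin m),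
      (∏ i : Fin d, ∑ J : Fin D → Fin m,
          (∏ r, g (σ (β (r, i)).2 (β (r, i)).1) (J r)) * v J) =
        ∑ J : Fin d → Fin D → Fin m,
          ∏ i : Fin d, ((∏ r, g (σ (β (r, i)).2 (β (r, i)).1) (J i r)) * v (J i)) := by
    intro σ
    rw [Finset.prod_univ_sum]
    rfl
  simp_rw [step1]
  -- Step 2: exchange the sums, split the products
  simp_rw [Finset.mul_sum, Finset.prod_mul_distrib]
  rw [Finset.sum_comm]
  -- Step 3: regroup the `g`-factors by boxes `(κ, j)` via `β` (eq. (3.3))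
  have step3 : ∀ (J : Fin d → Fin D → Fin m) (σ : Fin s → Equiv.Perm (Fin m)),
      (∏ i : Fin d, ∏ r : Fin D, g (σ (β (r, i)).2 (β (r, i)).1) (J i r)) =
        ∏ j : Fin s, ∏ κ : Fin m, g (σ j κ) (tableauOfSlots β J j κ) := by
    intro J σ
    rw [← Finset.prod_product', ← Finset.prod_product']
    refine Fintype.prod_equiv ((Equiv.prodComm _ _).trans (β.trans (Equiv.prodComm _ _))) _ _ ?_
    intro p
    simp only [Equiv.trans_apply, Equiv.prodComm_apply, Prod.swap, tableauOfSlots]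
    rw [show β.symm ((β (p.2, p.1)).1, (β (p.2, p.1)).2) = (p.2, p.1) by
      rw [Prod.mk.eta, Equiv.symm_apply_apply]]
  simp_rw [step3]
  -- Step 4: factor the sum over `(σ_1,…,σ_s)` column by column
  have step4 : ∀ J : Fin d → Fin D → Fin m,
      (∑ σ : Fin s → Equiv.Perm (Fin m),
        (∏ j, (Equiv.Perm.sign (σ j) : R)) *
          ((∏ j : Fin s, ∏ κ : Fin m, g (σ j κ) (tableauOfSlots β J j κ)) * ∏ i, v (J i))) =
      (∏ j : Fin s, ∑ τ : Equiv.Perm (Fin m),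
          (Equiv.Perm.sign τ : R) * ∏ κ, g (τ κ) (tableauOfSlots β J j κ)) * ∏ i, v (J i) := by
    intro J
    rw [Finset.prod_univ_sum, Finset.sum_mul]
    refine Finset.sum_congr rfl fun σ _ => ?_
    rw [← mul_assoc, ← Finset.prod_mul_distrib]
  simp_rw [step4]
  -- Step 5: `σ ↦ J(σ)`, `J(σ) i r = σ_{T_{r,i}}(T^{r,i})`, is injective; off its image some column
  -- of `Γ(J)` is not a permutation and the summand vanishes (Lemma 3.12)
  set φ : (Fin s → Equiv.Perm (Fin m)) → (Fin d → Fin D → Fin m) :=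
    fun σ i r => σ (β (r, i)).2 (β (r, i)).1 with hφ
  have hbox : ∀ (σ : Fin s → Equiv.Perm (Fin m)) (j : Fin s) (κ : Fin m),
      tableauOfSlots β (φ σ) j κ = σ j κ := by
    intro σ j κ
    simp only [tableauOfSlots, hφ]
    rw [Prod.mk.eta, Equiv.apply_symm_apply]
  have hinj : Function.Injective φ := by
    intro σ σ' h
    funext j
    ext κ
    rw [← hbox σ j κ, ← hbox σ' j κ, h]
  set G : (Fin d → Fin D → Fin m) → R := fun J =>
    (∏ j : Fin s, ∑ τ : Equiv.Perm (Fin m),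
        (Equiv.Perm.sign τ : R) * ∏ κ, g (τ κ) (tableauOfSlots β J j κ)) * ∏ i, v (J i) with hG
  have hzero : ∀ J : Fin d → Fin D → Fin m, J ∉ Finset.univ.image φ → G J = 0 := by
    intro J hJ
    by_cases hall : ∀ j : Fin s, Function.Bijective (tableauOfSlots β J j)
    · exfalso
      refine hJ (Finset.mem_image.mpr ⟨fun j => Equiv.ofBijective _ (hall j), Finset.mem_univ _, ?_⟩)
      funext i r
      simp only [hφ, Equiv.ofBijective_apply, tableauOfSlots]
      rw [Prod.mk.eta, Equiv.symm_apply_apply]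
    · obtain ⟨j, hj⟩ := not_forall.mp hall
      rw [hG]
      simp only
      rw [Finset.prod_eq_zero (Finset.mem_univ j), zero_mul]
      rw [BI2017_lem_3_12 g (tableauOfSlots β J j), dif_neg hj]
  have hsum : (∑ J : Fin d → Fin D → Fin m, G J) = ∑ J ∈ Finset.univ.image φ, G J := by
    symm
    exact Finset.sum_subset (Finset.subset_univ _) fun J _ hJ => hzero J hJ
  change (∑ J : Fin d → Fin D → Fin m, G J) = _
  rw [hsum, Finset.sum_image fun σ _ σ' _ h => hinj h]
  refine Finset.sum_congr rfl fun σ _ => ?_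
  -- Step 6: on the image every column sum is `sgn(σ_j) det(g)` (Lemma 3.12)
  have hcol : ∀ j : Fin s,
      (∑ τ : Equiv.Perm (Fin m), (Equiv.Perm.sign τ : R) * ∏ κ, g (τ κ) (tableauOfSlots β (φ σ) j κ)) =
        (Equiv.Perm.sign (σ j) : R) * g.det := by
    intro j
    have hfun : tableauOfSlots β (φ σ) j = ⇑(σ j) := funext (hbox σ j)
    rw [hfun, BI2017_lem_3_12 g ⇑(σ j), dif_pos (σ j).bijective]
    have he : Equiv.ofBijective (⇑(σ j)) (σ j).bijective = σ j := Equiv.ext fun _ => rfl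
    rw [he]
  rw [hG]
  simp only
  simp_rw [hcol]
  rw [Finset.prod_mul_distrib, Finset.prod_const, Finset.card_univ, Fintype.card_fin]
  ring

/-- **BI 2017, Thm. 3.11 — DISCHARGE of the named statement** `BI2017_thm_3_11`
(`\label{thm:PTnonzero}`, L1032). [cite: BurgisserIkenmeyer2017, Thm. 3.11] -/
theorem BI2017_thm_3_11_holds : BI2017_thm_3_11 :=
  fun _ _ _ _ _ _ β g v => tableauInv_tensorMul β g v

/-- The case `P_{D,m}` (row tableau) of Thm. 3.11 recovers the tree's `hyperdet_tensorMul`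
(consistency check). [cite: BurgisserIkenmeyer2017, Thm. 3.18(1)] -/
theorem tableauInv_prodComm_tensorMul (g : Matrix (Fin m) (Fin m) R) (v : (Fin D → Fin m) → R) :
    tableauInv (Equiv.prodComm (Fin D) (Fin m))
        (fun I => ∑ J : Fin D → Fin m, (∏ r, g (I r) (J r)) * v J) =
      g.det ^ D * hyperdet v :=
  tableauInv_tensorMul (Equiv.prodComm (Fin D) (Fin m)) g v

end TheoremThreeElevenProof

/-! ### §3.2 Howe's theorems, `m ≤ e(w)`, non-normality (named facts) -/

section HoweFacts

/-- **BI 2017, Thm. 3.14 (Howe 1987)** (`\label{th:howe}`, L1119, p0010:L83): "We have `O(Sym^D ℂ^m)^{SL_m}_d = 0` if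
`d < m`. Moreover, `O(Sym^D ℂ^m)^{SL_m}_m` is one-dimensional if `D` is even and zero-dimensional if
`D` is odd." Typed with `0 < d` (degree `0` holds the constants) and for `m ≥ 2`, `D ≥ 1` (for `m = 1`
the group `SL_1` is trivial and the second sentence fails for odd `D`; for `D = 0` the first fails) —
degenerate cases outside the paper's setting. [cite: BurgisserIkenmeyer2017, Thm. 3.14] -/
def BI2017_thm_3_14 : Prop :=
  ∀ (D m : ℕ), 1 ≤ D → 2 ≤ m →
    (∀ d : ℕ, 0 < d → d < m → slInvariantsOfDegree (Fin m) ℂ D d = ⊥) ∧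
    Module.finrank ℂ (slInvariantsOfDegree (Fin m) ℂ D m) = if Even D then 1 else 0

/-- **BI 2017, Thm. 3.15** (`\label{th:newmain}`, L1135, p0010:L97): "Assume that `w ∈ Sym^D ℂ^m` is polystable. Then
`m ≤ e(w)`. If `D` is odd, then this inequality is strict. Moreover, if `D` is even, then we have
`m = e(w)` iff `P_{D,m}(w) ≠ 0`. In this case, we have `Φ_w = P_{D,m}(w)^{-1} P_{D,m}` on
`\overline{Gw}`." Here `w ≠ 0` of degree `D ≥ 2` (standing assumptions) and `m ≥ 2` (the printed
proof rests on Thm. 3.14; for `m = 1`, `w = c x^D` with `D` odd has `e(w) = 1 = m`).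
[cite: BurgisserIkenmeyer2017, Thm. 3.15] -/
def BI2017_thm_3_15 : Prop :=
  ∀ (m D : ℕ) (f : MvPolynomial (Fin m) ℂ), 2 ≤ m → 2 ≤ D → f.IsHomogeneous D → f ≠ 0 →
    IsPolystable f →
    m ≤ minimalDegree D f ∧ (Odd D → m < minimalDegree D f) ∧
    (Even D → (minimalDegree D f = m ↔
      aeval (formCoeff D f) (cayleyP (k := ℂ) D (Equiv.refl (Fin m))) ≠ 0)) ∧
    (Even D → aeval (formCoeff D f) (cayleyP (k := ℂ) D (Equiv.refl (Fin m))) ≠ 0 →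
      IsFundamentalInvariant D f
        (C (aeval (formCoeff D f) (cayleyP (k := ℂ) D (Equiv.refl (Fin m))))⁻¹ *
          cayleyP D (Equiv.refl (Fin m))))

/-- **BI 2017, Cor. 3.16** (L1160, p0011:L4): "If `D` is even, then the generic minimal degree is
given by `e(D,m) = m`." (`D ≥ 2` even.) Typed unguarded in `m`: for `m ≥ 2` this is the printed
statement (Howe's Thm. 3.14 and `P_{D,m} ≠ 0`); `m = 1` is a genuine instance (`SL_1 = 1`, the
coordinate of `x^D` is an invariant of degree `1`); for `m = 0` there is no invariant of positive
degree at all and the equation holds only through the junk value `sInf ∅ = 0` of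
`genericMinimalDegree` (all three ranges are treated in the discharge `BI2017_cor_3_16_holds`,
`BI17GenericMinimalDegreeProofs.lean`). [cite: BurgisserIkenmeyer2017, Cor. 3.16] -/
def BI2017_cor_3_16 : Prop :=
  ∀ (D m : ℕ), Even D → 0 < D → genericMinimalDegree (Fin m) ℂ D = m

/-- **BI 2017, Cor. 3.17** (L1170, p0011:L13): "1. If `w ∈ Sym^D ℂ^m` satisfies `a(w) < D`, then
`\overline{Gw}` is not normal. 2. Suppose that `a'(D,m) = 1` and let `w ∈ Sym^D ℂ^m` be generic. Then
`\overline{Gw}` is not normal if `D` is odd, or if `D` is even and `gcd(D,m) > 1`." (`w ≠ 0`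
polystable of degree `D ≥ 2`; in part 1 "`a(w) < D`" includes finiteness, `0 < stabilizerPeriod`;
part 2's hypothesis "`a'(D,m) = 1`" is rendered as the generic value of `reducedStabilizerPeriod`,
and part 2 carries the section's standing `m ≥ 2` — its printed proof goes through Thm. 3.15
(`e(w) ≥ m`, `e(w) > m` for odd `D`), typed above with `2 ≤ m`. AS TYPED before 2026-08-26T13:05Z
part 2 was unguarded in `m` and false at `m ≤ 1` (at `m = 0`, `D = 2` the only form is `0` and
`O(\overline{G·0}) ≅ ℂ` is integrally closed; at `m = 1`, `D = 3` the orbit closure of `x³` is `𝔸¹`);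
AS CORRECTED: `2 ≤ m →` inserted in part 2, part 1 unchanged. Part 1 is the tree's theorem
`BI2017_cor_3_17_1` (`BI17DegreeExponentMonoidProofs.lean`).)
[cite: BurgisserIkenmeyer2017, Cor. 3.17] -/
def BI2017_cor_3_17 : Prop :=
  (∀ (m D : ℕ) (f : MvPolynomial (Fin m) ℂ), 2 ≤ D → f.IsHomogeneous D → f ≠ 0 → IsPolystable f →
    0 < stabilizerPeriod f → stabilizerPeriod f < D → ¬ IsIntegrallyClosed (OrbitCoordRing f D)) ∧
  ∀ (D m : ℕ), 2 ≤ D → 2 ≤ m →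
    IsZariskiGeneric D (fun f : MvPolynomial (Fin m) ℂ => reducedStabilizerPeriod D f = 1) →
    (Odd D ∨ 1 < Nat.gcd D m) →
    IsZariskiGeneric D fun f : MvPolynomial (Fin m) ℂ => ¬ IsIntegrallyClosed (OrbitCoordRing f D)

end HoweFacts

/-! ### Theorem 3.18: invariance and (non)vanishing of `P_{D,m}` (proved) -/

section TheoremThreeEighteen

variable {R : Type*} [CommRing R] {ℓ kk : ℕ}

/-- **For an odd number `ℓ` of slots and `kk ≥ 2`, the hyperdeterminant vanishes identically**
(BI 2017, proof of Thm. 3.18(2), L1207–1216: replacing every `σ_j` by `σ_j ∘ (12)` changes the sign by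
`(-1)^D` and permutes the factors of the product, so `P_{D,m}(v) = -P_{D,m}(v)`), over any
commutative ring in which `2` is not a zero divisor. [cite: BurgisserIkenmeyer2017, Thm. 3.18(2)] -/
theorem hyperdet_eq_neg_of_odd (hℓ : Odd ℓ) (hk : 2 ≤ kk) (A : (Fin ℓ → Fin kk) → R) :
    hyperdet A = -hyperdet A := by
  classical
  -- the transposition `(0 1)` of `Fin kk`
  set a : Fin kk := ⟨0, by omega⟩ with ha
  set b : Fin kk := ⟨1, by omega⟩ with hb
  have hab : a ≠ b := by simp [ha, hb, Fin.ext_iff]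
  set τ : Equiv.Perm (Fin kk) := Equiv.swap a b with hτ
  -- the involution `σ ↦ (σ_j ∘ τ)_j` on tuples of permutations
  let Φ : (Fin ℓ → Equiv.Perm (Fin kk)) ≃ (Fin ℓ → Equiv.Perm (Fin kk)) :=
    { toFun := fun σ j => (σ j) * τ
      invFun := fun σ j => (σ j) * τ
      left_inv := fun σ => by funext j; simp [hτ, mul_assoc, Equiv.swap_mul_self]
      right_inv := fun σ => by funext j; simp [hτ, mul_assoc, Equiv.swap_mul_self] }
  unfold hyperdet
  conv_lhs => rw [← Equiv.sum_comp Φ]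
  rw [← Finset.sum_neg_distrib]
  refine Finset.sum_congr rfl fun σ _ => ?_
  -- signs: `∏ sgn(σ_j τ) = (-1)^ℓ ∏ sgn σ_j = - ∏ sgn σ_j`
  have hsign : (∏ j, (Equiv.Perm.sign (Φ σ j) : R)) = -∏ j, (Equiv.Perm.sign (σ j) : R) := by
    have : ∀ j, (Equiv.Perm.sign (Φ σ j) : R) = -(Equiv.Perm.sign (σ j) : R) := by
      intro j
      change ((Equiv.Perm.sign (σ j * τ) : ℤˣ) : R) = _
      rw [map_mul, Equiv.Perm.sign_swap hab, Units.val_mul, Int.cast_mul]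
      simp
    simp_rw [this]
    rw [Finset.prod_neg (f := fun j => (Equiv.Perm.sign (σ j) : R)), Finset.card_univ,
      Fintype.card_fin, Odd.neg_one_pow hℓ, neg_one_mul]
  -- products: reindex `i ↦ τ i`
  have hprod : (∏ i, A fun j => Φ σ j i) = ∏ i, A fun j => σ j i := by
    change (∏ i, A fun j => (σ j * τ) i) = _
    simp only [Equiv.Perm.mul_apply]
    exact Equiv.prod_comp τ (fun i => A fun j => σ j i)
  rw [hsign, hprod, neg_mul]

/-- The hyperdeterminant with an odd number of slots (and `kk ≥ 2`) is identically zero when `2` is a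
non-zero-divisor, e.g. over a field of characteristic `≠ 2` (BI 2017 Thm. 3.18(2): "`P_{D,m}(w) = 0`
for any `w ∈ ⊗^D ℂ^m`" if `D` is odd, `m ≥ 2`). [cite: BurgisserIkenmeyer2017, Thm. 3.18(2)] -/
theorem hyperdet_eq_zero_of_odd [NoZeroDivisors R] [CharZero R] (hℓ : Odd ℓ) (hk : 2 ≤ kk)
    (A : (Fin ℓ → Fin kk) → R) : hyperdet A = 0 := by
  have h := hyperdet_eq_neg_of_odd hℓ hk A
  have h2 : (2 : R) * hyperdet A = 0 := by rw [two_mul]; nth_rw 2 [h]; exact add_neg_cancel _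
  rcases mul_eq_zero.mp h2 with h2 | h2
  · exact absurd h2 two_ne_zero
  · exact h2

variable {σ k : Type*} [Fintype σ] [DecidableEq σ] [Field k] {m D : ℕ}

/-- **BI 2017, Thm. 3.18(1)** (`\label{th:explicit-invar-forms}`, L1195, p0011:L35): "We have `P_{D,m}(gv) = (det g)^D P_{D,m}(v)` for
all `g ∈ GL_m` and `v ∈ ⊗^D ℂ^m`" — on forms: for every square matrix `B` (acting by `linSubst`,
`X_i ↦ ∑_x B_{xi} X_x`) and every form `q` of degree `D`, `P_{D,m}(B · q) = det(B)^D P_{D,m}(q)`.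
Proof: the array of `B · q` is `(B,…,B) · A(q)` (`arrOf_linSubst`) and `hyperdet_tensorMul`
(characteristic zero for the symmetric-array normalisation). [cite: BurgisserIkenmeyer2017, Thm. 3.18(1)] -/
theorem BI2017_thm_3_18_1 [CharZero k] (B : Matrix (Fin m) (Fin m) k) {q : MvPolynomial (Fin m) k}
    (hq : q.IsHomogeneous D) :
    aeval (formCoeff D (linSubst (Fin m) k B q)) (cayleyP (k := k) D (Equiv.refl (Fin m))) =
      B.det ^ D * aeval (formCoeff D q) (cayleyP (k := k) D (Equiv.refl (Fin m))) := by
  rw [cayleyP, aeval_formCoeff_hyperdetPoly, aeval_formCoeff_hyperdetPoly]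
  have harr : (fun J : Fin D → Fin m => arrOf D (linSubst (Fin m) k B q) ((Equiv.refl (Fin m)) ∘ J)) =
      fun I => ∑ J : Fin D → Fin m, (∏ r, B (I r) (J r)) * arrOf D q ((Equiv.refl (Fin m)) ∘ J) := by
    funext I
    exact arrOf_linSubst B hq I
  rw [harr, hyperdet_tensorMul]

/-- **BI 2017, Thm. 3.18(2), odd case** (L1201, L1207–1216): for `D` odd and `m ≥ 2` the polynomial
`P_{D,m}` is zero (in characteristic zero). [cite: BurgisserIkenmeyer2017, Thm. 3.18(2)] -/
theorem cayleyP_eq_zero_of_odd [CharZero k] (hD : Odd D) (hm : 2 ≤ m) (t : Fin m ≃ σ) :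
    cayleyP (k := k) D t = 0 := by
  rw [cayleyP, hyperdetPoly]
  exact hyperdet_eq_zero_of_odd hD hm _

end TheoremThreeEighteen

section TheoremThreeEighteenEven

-- as in `Hyperdeterminant.lean` §HyperdetEval, the variables carry a linear order (its
-- `DecidableEq` instance is the one used there)
variable {σ k : Type*} [Fintype σ] [LinearOrder σ] [Field k] {m D : ℕ}

/-- **BI 2017, Thm. 3.18(2), the value at the power sum** (L1202, L1218–1224): for `D ≥ 1` even,
"`P_{D,m}(X_1^D + ⋯ + X_m^D) = m! ≠ 0`" (only tuples of equal permutations contribute, each with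
`sgn(σ)^D = 1`); the tree's `aeval_hyperdetPoly_scaled_powerSum` with all scalars `1`.
[cite: BurgisserIkenmeyer2017, Thm. 3.18(2)] -/
theorem BI2017_thm_3_18_2_powerSum (hD : Even D) (hD0 : 0 < D) (t : Fin m ≃ σ) :
    aeval (formCoeff D (∑ a, X (t a) ^ D : MvPolynomial σ k)) (cayleyP (k := k) D t) =
      (Nat.factorial m : k) := by
  have h := aeval_hyperdetPoly_scaled_powerSum (k := k) (σ := σ) t.injective hD0 hD (fun _ => 1)
  simp only [one_mul, Finset.prod_const_one, mul_one] at h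
  exact h

/-- **BI 2017, Thm. 3.18(2)** (`\label{th:explicit-invar-forms}`, L1201, p0011:L35): "Let `m ≥ 2`. Then the polynomial `P_{D,m}` is
nonzero iff `D` is even." (`D ≥ 1`; characteristic zero.) [cite: BurgisserIkenmeyer2017, Thm. 3.18(2)] -/
theorem BI2017_thm_3_18_2 [CharZero k] (hm : 2 ≤ m) (hD0 : 0 < D) (t : Fin m ≃ σ) :
    cayleyP (k := k) D t ≠ 0 ↔ Even D := by
  constructor
  · intro h
    by_contra hodd
    exact h (cayleyP_eq_zero_of_odd (Nat.not_even_iff_odd.mp hodd) hm t)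
  · intro hD h
    have hv := BI2017_thm_3_18_2_powerSum (k := k) hD hD0 t
    rw [h, map_zero] at hv
    exact Nat.cast_ne_zero.mpr (Nat.factorial_ne_zero m) hv.symm

end TheoremThreeEighteenEven

/-! ### §3.2 Lemma 3.19, Theorems 3.21–3.22 (named facts) -/

section OddFacts

/-- **BI 2017, Lemma 3.19** (`\label{le:irred}`, L1232, p0011:L70): "`P_{D,m}` is an irreducible polynomial of degree `m`
if `D` is even." (`D ≥ 2`, `m ≥ 1`; the degree is `isHomogeneous_hyperdetPoly`; irreducibility from
Thm. 3.14: a nonzero invariant of smallest degree, cf. Ottaviani 2009 p. 105.)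
[cite: BurgisserIkenmeyer2017, Lemma 3.19] -/
def BI2017_lem_3_19 : Prop :=
  ∀ (D m : ℕ), Even D → 0 < D → 1 ≤ m → Irreducible (cayleyP (k := ℂ) D (Equiv.refl (Fin m)))

/-- **BI 2017, Thm. 3.21 (Howe)** (`\label{th:howeODD}`, L1251, p0011:L87): "If `D` is odd,
`dim O(Sym^D ℂ^D)^{SL_D}_{D+1} = 1`, otherwise `O(Sym^D ℂ^D)^{SL_D}_{D+1} = 0`." (`D ≥ 1`.)
[cite: BurgisserIkenmeyer2017, Thm. 3.21] -/
def BI2017_thm_3_21 : Prop :=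
  ∀ D : ℕ, 0 < D →
    Module.finrank ℂ (slInvariantsOfDegree (Fin D) ℂ D (D + 1)) = if Odd D then 1 else 0

/-- **BI 2017, Thm. 3.22** (`\label{th:explicit-invar-formsODD}`, L1266, p0011:L103): "1. We have `P_D(gv) = (det g)^{D+1} P_D(v)` for all
`g ∈ GL_D` and `v ∈ ⊗^D ℂ^D`. 2. The polynomial `P_D` is nonzero iff `D` is odd." Part 1 is the case
`β = cyclicTableau D` (`s = D + 1`) of Thm. 3.11; part 2 is typed for `P_D` as a polynomial function
on `Sym^D ℂ^D` (`oddCayleyP`; the printed proof evaluates at `α(X_1+⋯+X_D)^D + X_1^D+⋯+X_D^D`, the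
vanishing for even `D` is Thm. 3.21). (`D ≥ 1`.) [cite: BurgisserIkenmeyer2017, Thm. 3.22] -/
def BI2017_thm_3_22 : Prop :=
  (∀ (R : Type) [CommRing R] (D : ℕ) (g : Matrix (Fin D) (Fin D) R) (v : (Fin D → Fin D) → R),
    tableauInv (cyclicTableau D) (fun I => ∑ J : Fin D → Fin D, (∏ r, g (I r) (J r)) * v J) =
      g.det ^ (D + 1) * tableauInv (cyclicTableau D) v) ∧
  ∀ D : ℕ, 0 < D → (oddCayleyP (k := ℂ) D (Equiv.refl (Fin D)) ≠ 0 ↔ Odd D)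

/-- Thm. 3.22(1) is the cyclic-tableau case of Thm. 3.11. [cite: BurgisserIkenmeyer2017, Thm. 3.22(1)] -/
theorem BI2017_thm_3_22_1_of_thm_3_11 (h : BI2017_thm_3_11) (R : Type) [CommRing R] (D : ℕ)
    (g : Matrix (Fin D) (Fin D) R) (v : (Fin D → Fin D) → R) :
    tableauInv (cyclicTableau D) (fun I => ∑ J : Fin D → Fin D, (∏ r, g (I r) (J r)) * v J) =
      g.det ^ (D + 1) * tableauInv (cyclicTableau D) v :=
  h R D (D + 1) D (D + 1) (cyclicTableau D) g v

/-- **BI 2017, Thm. 3.22(1), PROVED** (`\label{th:explicit-invar-formsODD}`, L1266):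
`P_D(gv) = (det g)^{D+1} P_D(v)` — the cyclic-tableau case of Thm. 3.11. [cite: BurgisserIkenmeyer2017, Thm. 3.22(1)] -/
theorem BI2017_thm_3_22_1 {R : Type*} [CommRing R] (D : ℕ) (g : Matrix (Fin D) (Fin D) R)
    (v : (Fin D → Fin D) → R) :
    tableauInv (cyclicTableau D) (fun I => ∑ J : Fin D → Fin D, (∏ r, g (I r) (J r)) * v J) =
      g.det ^ (D + 1) * tableauInv (cyclicTableau D) v :=
  tableauInv_tensorMul (cyclicTableau D) g v

end OddFacts

/-! ### §3.3 Minimal degree for specific forms -/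

section SpecificForms

/-- **BI 2017, Prop. 3.24** (`\label{pro:evenodd}`, L1315, p0012:L28): "Let `w = X_1^D + ⋯ + X_m^D`. 1. If `D` is even, then
`w` has the degree period `b(w) = m` and minimal degree `e(w) = m`. 2. If `D` is odd, then `w` has the
degree period `b(w) = 2m`. If additionally `2m ≤ binom(2D, D)`, then we have `e(w) = 2m`. 3. If `D`
is odd and `2m > binom(2D, D)`, we have `e(w) > 2m`. In the cases 1 and 2, we have `e'(w) = 1`. In
case 3, we have `e'(w) > 1`." (`D ≥ 2`; `m ≥ 2` — part 2 uses Prop. 2.4(2), `m > 1`; for `m = 1`,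
`w = x^D` has `b(w) = 1`.) [cite: BurgisserIkenmeyer2017, Prop. 3.24] -/
def BI2017_prop_3_24 : Prop :=
  ∀ (D m : ℕ), 2 ≤ D → 2 ≤ m →
    let w : MvPolynomial (Fin m) ℂ := ∑ i : Fin m, X i ^ D
    (Even D → degreePeriod D w = m ∧ minimalDegree D w = m ∧ minimalExponent D w = 1) ∧
    (Odd D → degreePeriod D w = 2 * m ∧
      (2 * m ≤ Nat.choose (2 * D) D → minimalDegree D w = 2 * m ∧ minimalExponent D w = 1)) ∧
    (Odd D → Nat.choose (2 * D) D < 2 * m → 2 * m < minimalDegree D w ∧ 1 < minimalExponent D w)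

/-- **BI 2017, Prop. 3.25** (`\label{pro:ps-pr-expr}`, L1411, p0013:L26; due to Kumar 2015 and Kumar–Landsberg 2015): "Let `m`
be even. Then `e(X_1⋯X_m) ≥ m` and equality holds iff the Alon-Tarsi [hypothesis `AT(m)`] is true
for `m`." — a proved EQUIVALENCE between the value of the minimal degree and the Alon–Tarsi
statement `AT(m)`: "the number of column-even Latin squares of size `m` is different from the number
of column-odd Latin squares of size `m`" (L1403), i.e. `Kumar2015.latinColCount m ≠ 0`
(`KumarLatinRectangles.lean`; known for `m = p ± 1`, Drisko/Glynn). (`m ≥ 2` even;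
`X_1⋯X_m` = `chowMonomial ℂ m`.) [cite: BurgisserIkenmeyer2017, Prop. 3.25] -/
def BI2017_prop_3_25 : Prop :=
  ∀ m : ℕ, Even m → 2 ≤ m →
    m ≤ minimalDegree m (∏ i : Fin m, X i : MvPolynomial (Fin m) ℂ) ∧
    (minimalDegree m (∏ i : Fin m, X i : MvPolynomial (Fin m) ℂ) = m ↔ Kumar2015.latinColCount m ≠ 0)

/-- An `m × d` **Latin annulus** (BI 2017 Rem. 3.26, L1443): "an `m × d` matrix where in each column
and in each diagonal `((1,i),(2,i+1),(3,i+2),…,(m,i+m-1))` each number from `1,…,m` occurs exactly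
once, where the column indices are taken modulo `d`" (`A κ j` = entry in row `κ`, column `j`).
[cite: BurgisserIkenmeyer2017, Rem. 3.26] -/
def IsLatinAnnulus {m d : ℕ} (A : Fin m → Fin d → Fin m) : Prop :=
  (∀ j : Fin d, Function.Bijective fun κ : Fin m => A κ j) ∧
  ∀ i : Fin d, Function.Bijective fun κ : Fin m =>
    A κ ⟨((i : ℕ) + (κ : ℕ)) % d, Nat.mod_lt _ i.pos⟩

/-- The column-sign of an `m × d` array: "the product of the signs of the permutations in its
columns" (BI 2017 Rem. 3.26, L1447; `Kumar2015.seqSign` = sign of a sequence, `KumarLatinRectangles.lean`).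
[cite: BurgisserIkenmeyer2017, Rem. 3.26] -/
def annulusColSign {m d : ℕ} (A : Fin m → Fin d → Fin m) : ℤˣ :=
  ∏ j : Fin d, Kumar2015.seqSign fun κ : Fin m => A κ j

open Classical in
/-- The signed count `#{even m × d Latin annuli} − #{odd m × d Latin annuli}` (BI 2017 Rem. 3.26).
[cite: BurgisserIkenmeyer2017, Rem. 3.26] -/
def latinAnnulusCount (m d : ℕ) : ℤ :=
  ∑ A ∈ (Finset.univ : Finset (Fin m → Fin d → Fin m)).filter (fun A => IsLatinAnnulus A),
    ((annulusColSign A : ℤˣ) : ℤ)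

/-- **BI 2017, Rem. 3.26** (L1439–1461, p0013:L54): "The Alon-Tarsi [statement `AT(m)`] is
equivalent to saying that for even `m` the number of even `m × m` Latin Annuli is different from the
number of odd `m × m` Latin Annuli. … for odd `m` `P_m(w_m) ≠ 0` iff the number of even `m × (m+1)`
Latin Annuli is different from the number of odd `m × (m+1)` Latin Annuli. Therefore for odd `m` we
have `e(X_1…X_m) = m + 1` iff [that]. We verified that [it holds] for `m = 1, 3, 5,` and `7`." —
three proved equivalences and a computer verification of the source (`AT(m)` =
`Kumar2015.latinColCount m ≠ 0`). [cite: BurgisserIkenmeyer2017, Rem. 3.26] -/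
def BI2017_rem_3_26 : Prop :=
  (∀ m : ℕ, Even m → 2 ≤ m → (Kumar2015.latinColCount m ≠ 0 ↔ latinAnnulusCount m m ≠ 0)) ∧
  (∀ m : ℕ, Odd m →
    (aeval (formCoeff m (∏ i : Fin m, X i : MvPolynomial (Fin m) ℂ))
        (oddCayleyP (k := ℂ) m (Equiv.refl (Fin m))) ≠ 0 ↔ latinAnnulusCount m (m + 1) ≠ 0)) ∧
  (∀ m : ℕ, Odd m → 3 ≤ m →
    (minimalDegree m (∏ i : Fin m, X i : MvPolynomial (Fin m) ℂ) = m + 1 ↔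
      latinAnnulusCount m (m + 1) ≠ 0)) ∧
  (latinAnnulusCount 1 2 ≠ 0 ∧ latinAnnulusCount 3 4 ≠ 0 ∧ latinAnnulusCount 5 6 ≠ 0 ∧
    latinAnnulusCount 7 8 ≠ 0)

/-- **BI 2017, §3.3, minimal degree of `det_n` and `per_n`** (L1456–1462, p0013; and Rem. 3.27,
L1464): "we obtain that `e(det_n) ≥ n²`, with equality holding iff `P_{n,n²}(det_n) ≠ 0`. (An
analogous statement holds for `per_n`.)"; Rem. 3.27: "`det_2` and `per_2` are quadratic forms of full
rank … Hence `P_{2,4}(det_2)` and `P_{2,4}(per_2)` are nonzero". (`n ≥ 2`; `P_{n,n²}` on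
`Sym^n ℂ^{n×n}` with the `n²` variables enumerated by `finProdFinEquiv`.)
[cite: BurgisserIkenmeyer2017, §3.3 (before Rem. 3.27) and Rem. 3.27] -/
def BI2017_minimalDegree_det_per : Prop :=
  (∀ n : ℕ, 2 ≤ n →
    (n * n ≤ minimalDegree n (detPoly (Fin n) ℂ) ∧
      (minimalDegree n (detPoly (Fin n) ℂ) = n * n ↔
        aeval (formCoeff n (detPoly (Fin n) ℂ))
          (cayleyP (k := ℂ) n (finProdFinEquiv.symm : Fin (n * n) ≃ Fin n × Fin n)) ≠ 0)) ∧
    (n * n ≤ minimalDegree n (perPoly (Fin n) ℂ) ∧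
      (minimalDegree n (perPoly (Fin n) ℂ) = n * n ↔
        aeval (formCoeff n (perPoly (Fin n) ℂ))
          (cayleyP (k := ℂ) n (finProdFinEquiv.symm : Fin (n * n) ≃ Fin n × Fin n)) ≠ 0))) ∧
  aeval (formCoeff 2 (detPoly (Fin 2) ℂ))
      (cayleyP (k := ℂ) 2 (finProdFinEquiv.symm : Fin (2 * 2) ≃ Fin 2 × Fin 2)) ≠ 0 ∧
  aeval (formCoeff 2 (perPoly (Fin 2) ℂ))
      (cayleyP (k := ℂ) 2 (finProdFinEquiv.symm : Fin (2 * 2) ≃ Fin 2 × Fin 2)) ≠ 0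

/-- An **admissible `n`-table** (BI 2017 §3.3, L1478–1490): a pair `(S, T)` of maps
`[n²] × [n] → [n]` ("viewed as matrices of format `n² × n`, with entries in `[n]`, in which each row
`S(i,·)` is a permutation of `[n]`", likewise `T`) such that "each column of the table `(S,T)`
enumerates `[n] × [n]`, that is, for all `j`, `[n²] → [n] × [n], i ↦ (S(i,j), T(i,j))` is bijective".
[cite: BurgisserIkenmeyer2017, §3.3 (admissible tables)] -/
def IsAdmissibleTable {n : ℕ} (S T : Fin (n * n) → Fin n → Fin n) : Prop :=
  (∀ i, Function.Bijective (S i)) ∧ (∀ i, Function.Bijective (T i)) ∧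
  ∀ j : Fin n, Function.Bijective fun i : Fin (n * n) => (S i j, T i j)

/-- The row-sign of `S`: "the product of the signs of the rows" (BI 2017 §3.3, L1481).
[cite: BurgisserIkenmeyer2017, §3.3 (admissible tables)] -/
def tableRowSign {n : ℕ} (S : Fin (n * n) → Fin n → Fin n) : ℤˣ :=
  ∏ i, Kumar2015.seqSign (S i)

/-- The column-sign `colsgn(S,T)` of a table: the product over the columns `j` of the signs of the
maps `i ↦ (S(i,j), T(i,j))`, "well-defined after fixing an ordering of `[n] × [n]`" (BI 2017 §3.3,
L1486) — here the ordering `finProdFinEquiv : [n] × [n] ≃ [n²]`. [cite: BurgisserIkenmeyer2017, §3.3 (admissible tables)] -/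
def tableColSign {n : ℕ} (S T : Fin (n * n) → Fin n → Fin n) : ℤˣ :=
  ∏ j : Fin n, Kumar2015.seqSign fun i : Fin (n * n) => finProdFinEquiv (S i j, T i j)

open Classical in
/-- `#{even admissible n-tables} − #{odd admissible n-tables}`, the sign of `(S,T)` being "the product
of its row and column sign", the row sign "the product of the row-sign of `S` and the row-sign of
`T`" (BI 2017 §3.3, L1492–1496). [cite: BurgisserIkenmeyer2017, §3.3 (admissible tables)] -/
def admissibleTableCount (n : ℕ) : ℤ :=
  ∑ ST ∈ (Finset.univ : Finset ((Fin (n * n) → Fin n → Fin n) × (Fin (n * n) → Fin n → Fin n))).filter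
      (fun ST => IsAdmissibleTable ST.1 ST.2),
    ((tableRowSign ST.1 * tableRowSign ST.2 * tableColSign ST.1 ST.2 : ℤˣ) : ℤ)

open Classical in
/-- `#{column-even admissible n-tables} − #{column-odd admissible n-tables}` (BI 2017 §3.3, L1489).
[cite: BurgisserIkenmeyer2017, §3.3 (admissible tables)] -/
def admissibleTableColCount (n : ℕ) : ℤ :=
  ∑ ST ∈ (Finset.univ : Finset ((Fin (n * n) → Fin n → Fin n) × (Fin (n * n) → Fin n → Fin n))).filter
      (fun ST => IsAdmissibleTable ST.1 ST.2),
    ((tableColSign ST.1 ST.2 : ℤˣ) : ℤ)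

/-- **BI 2017, Prop. 3.28** (`\label{re:eval-P-det-per}`, L1501, p0013:L112): "`P_{n,n²}(det_n)` is the difference between the
number of even and odd admissible `n`-tables. `P_{n,n²}(per_n)` is the difference between the number
of column-even and column odd admissible `n`-tables." The printed identification of `det_n`, `per_n`
with symmetric tensors carries the factor `1/n!` (L1513, L1520:
`det_n := (1/n!) ∑_{ρ,σ} sgn ρ sgn σ |(ρ(1),σ(1))⋯(ρ(n),σ(n))⟩`, which is the tree's symmetric array
`arrOf n det_n`), one factor for each of the `n²` entries of a summand of eq. (3.5); the equalities are
therefore typed with the explicit normalisation `(n!)^{n²} · P_{n,n²}(det_n) = #even − #odd`. Letters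
and the ordering of `[n] × [n]` both via `finProdFinEquiv`. [cite: BurgisserIkenmeyer2017, Prop. 3.28] -/
def BI2017_prop_3_28 : Prop :=
  ∀ n : ℕ,
    (Nat.factorial n : ℂ) ^ (n * n) *
        aeval (formCoeff n (detPoly (Fin n) ℂ))
          (cayleyP (k := ℂ) n (finProdFinEquiv.symm : Fin (n * n) ≃ Fin n × Fin n)) =
      (admissibleTableCount n : ℂ) ∧
    (Nat.factorial n : ℂ) ^ (n * n) *
        aeval (formCoeff n (perPoly (Fin n) ℂ))
          (cayleyP (k := ℂ) n (finProdFinEquiv.symm : Fin (n * n) ≃ Fin n × Fin n)) =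
      (admissibleTableColCount n : ℂ)

/-- **BI 2017, §3.3, computer verification** (L1533–1536): "Based on Proposition 3.28 we have
verified that `P_{4,16}(per_4)` and `P_{4,16}(det_4)` are nonzero, using computer calculations."
(A computational claim of the source; together with Thm. 3.15: `e(det_4) = e(per_4) = 16`.)
[cite: BurgisserIkenmeyer2017, §3.3 (after Prop. 3.28)] -/
def BI2017_P416_det_per : Prop :=
  aeval (formCoeff 4 (detPoly (Fin 4) ℂ))
      (cayleyP (k := ℂ) 4 (finProdFinEquiv.symm : Fin (4 * 4) ≃ Fin 4 × Fin 4)) ≠ 0 ∧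
  aeval (formCoeff 4 (perPoly (Fin 4) ℂ))
      (cayleyP (k := ℂ) 4 (finProdFinEquiv.symm : Fin (4 * 4) ≃ Fin 4 × Fin 4)) ≠ 0

/-- **BI 2017, Cor. 3.29** (`\label{cor:not-normal}`, L1538, p0014:L28): "1. The orbit closure of `X_1⋯X_m` is not normal if
`m > 2`. 2. The orbit closures of `det_n` and `per_n` are not normal if `n > 2`." (`GL`-orbit closures
in `Sym^m ℂ^m`, resp. `Sym^n ℂ^{n×n}`; normality = integrally closed coordinate ring
`OrbitCoordRing`. The text adds that the orbit closures of `X_1X_2`, `det_2`, `per_2` ARE normal,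
L1552.) [cite: BurgisserIkenmeyer2017, Cor. 3.29] -/
def BI2017_cor_3_29 : Prop :=
  (∀ m : ℕ, 2 < m →
    ¬ IsIntegrallyClosed (OrbitCoordRing (∏ i : Fin m, X i : MvPolynomial (Fin m) ℂ) m)) ∧
  ∀ n : ℕ, 2 < n →
    ¬ IsIntegrallyClosed (OrbitCoordRing (detPoly (Fin n) ℂ) n) ∧
    ¬ IsIntegrallyClosed (OrbitCoordRing (perPoly (Fin n) ℂ) n)

end SpecificForms

/-! ### Appendix A.1 (plethysm upper bounds) and A.2 (generic stabilizers of binary/ternary forms) -/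

section Appendix

open Literature.NumberTheory.DiophantineGeometry in
/-- The number `q_λ(d)` of "sets `S` of type `λ` in degree `d`" (BI 2017 Appendix = §7 of the arXiv version, Prop. 7.1, L2871):
sets `S` of subsets of `{1,…,λ_1}` with `|S| = d`, every `s ∈ S` of cardinality `D`, and each
number `i` occurring in exactly `λ^t_i` members of `S` (`λ^t_i` = length of the `i`-th column of
`λ` = number of parts `≥ i`). Numbers `1,…,λ_1` are `Fin λ_1` (`λ_1 = lam.parts.sup`).
[cite: BurgisserIkenmeyer2017, §7 (Appendix) Prop. 7.1] -/
def typeSetCount {n : ℕ} (lam : Nat.Partition n) (D d : ℕ) : ℕ :=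
  ((Finset.univ : Finset (Finset (Finset (Fin lam.parts.sup)))).filter fun S =>
    S.card = d ∧ (∀ s ∈ S, s.card = D) ∧
      ∀ i : Fin lam.parts.sup,
        (S.filter fun s => i ∈ s).card = lam.parts.countP fun p => (i : ℕ) + 1 ≤ p).card

open Literature.NumberTheory.DiophantineGeometry in
/-- **BI 2017, Appendix = §7, Prop. 7.1** (`\label{pro:plethupperbound}`, L2871, p0026:L8; via Manivel–Michałek 2014 Fact 6.1,
`Sym^d Sym^D ↔ ∧^d ∧^D` for odd `D`): "Let `D` be odd and let `λ` be a partition of `Dd` into at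
most `m` parts. Let `mult_λ(O(Sym^D ℂ^m)_d)` denote the multiplicity of the irreducible
`GL_m`-representation of type `λ*` in `O(Sym^D ℂ^m)_d`. … Then `mult_λ(O(Sym^D ℂ^m)_d) ≤ q_λ(d)`."
The multiplicity of type `λ*` (dual) in `k[Sym^D k^m]` is the tree's
`plethysmCoeffOfPartition ℂ m D λ` (`SchurWeylPlethysm.lean`, dual convention of `coordRep`).
[cite: BurgisserIkenmeyer2017, §7 (Appendix) Prop. 7.1] -/
def BI2017_prop_A_1 : Prop :=
  ∀ (D d m : ℕ) (lam : Nat.Partition (D * d)), Odd D → lam.parts.card ≤ m →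
    plethysmCoeffOfPartition ℂ m D lam ≤ typeSetCount lam D d

/-- **BI 2017, Appendix = §7, Cor. 7.2** (`\label{cor:plethupperbound}`, L2897, p0026:L41): "Let `D` be odd and let `Dd` be divisible by `m`. The
dimension of the `SL_m`-invariant space in `O(Sym^D ℂ^m)_d` is bounded from above by the number of
cardinality `d` sets of cardinality `D` subsets of `{1,…,dD/m}` such that each number occurs in
precisely `m` of the subsets." (`m ≥ 1`. Used in Prop. 3.24(3).) [cite: BurgisserIkenmeyer2017, §7 (Appendix) Cor. 7.2] -/
def BI2017_cor_A_2 : Prop :=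
  ∀ (D d m : ℕ), Odd D → 1 ≤ m → m ∣ D * d →
    Module.finrank ℂ (slInvariantsOfDegree (Fin m) ℂ D d) ≤
      ((Finset.univ : Finset (Finset (Finset (Fin (D * d / m))))).filter fun S =>
        S.card = d ∧ (∀ s ∈ S, s.card = D) ∧
          ∀ i : Fin (D * d / m), (S.filter fun s => i ∈ s).card = m).card

/-- **BI 2017, Appendix = §7, Prop. 7.4 (binary forms)** (`\label{stab:bin-forms}`, L2925, p0026:L68): "1. For a generic `w ∈ Sym³ℂ²` we have
`stab(w) ≃ μ_3 ⋊ S_2`. Hence `a(3,2) = 6` and `a'(3,2) = 2`. 2. For a generic `w ∈ Sym⁴ℂ²` we have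
`stab(w) ≃ C_2 × C_2`. Hence `a(4,2) = 2` and `a'(4,2) = 1`. 3. Let `D ≥ 5`. The stabilizer of a
generic `w ∈ Sym^D ℂ²` is trivial, hence `a'(D,2) = 1`." Typed: the generic stabilizer periods and
the generic trivial stabilizer (the group isomorphisms, stated in the source modulo the scalar
matrices `ζ I` with `ζ^D = 1`, are not typed; the proof of 3 is omitted in the source).
[cite: BurgisserIkenmeyer2017, §7 (Appendix) Prop. 7.4] -/
def BI2017_prop_A_4 : Prop :=
  IsZariskiGeneric 3 (fun f : MvPolynomial (Fin 2) ℂ =>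
      stabilizerPeriod f = 6 ∧ reducedStabilizerPeriod 3 f = 2) ∧
  IsZariskiGeneric 4 (fun f : MvPolynomial (Fin 2) ℂ =>
      stabilizerPeriod f = 2 ∧ reducedStabilizerPeriod 4 f = 1) ∧
  ∀ D : ℕ, 5 ≤ D →
    IsZariskiGeneric D (fun f : MvPolynomial (Fin 2) ℂ =>
      HasTrivialStabilizer D f ∧ reducedStabilizerPeriod D f = 1)

/-- **BI 2017, Appendix = §7, Prop. 7.5 (ternary forms)** (`\label{stab:tern-forms}`, L2976, p0026:L118): "1. A generic `w ∈ Sym³ℂ³` satisfies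
`stab(w) ≃ μ_3 ⋊ S_3`. Hence `a'(3,3) = 2`. 2. For a generic `w ∈ Sym⁴ℂ³` we have `stab(w) ≃ C_2`.
Hence `a'(4,3) = 2`. 3. Let `D ≥ 5`. The stabilizer of a generic `w ∈ Sym^D ℂ³` is trivial, hence
`a'(D,3) = 1`." Typed as the generic reduced stabilizer periods / trivial stabilizer (group
isomorphisms, modulo scalars in the source, not typed).
⚠ A21: part 2 (`(D,m) = (4,3)`: "`stab(w) ≃ C_2`. Hence `a'(4,3) = 2`") is CONTRADICTED AS PRINTED —
every ternary quartic has `stab(w) ⊇ μ₄·I`, and generic plane quartics have trivial linear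
automorphism group [Poonen 2005, Thm. 3/4; Huybrechts 2023, Thm. 3.15; Chang 1978; Katz–Sarnak
10.6.18], so generically `stab(w) = μ₄·I`, `a(4,3) = 4`, `a'(4,3) = 1`. DO NOT CONSUME this Prop
(its second conjunct is typed verbatim from the print and is false-by-literature); no safe variant is
typed (no consumer). See the module docstring, "Erratum A21". [cite: BurgisserIkenmeyer2017, §7 (Appendix) Prop. 7.5] -/
def BI2017_prop_A_5 : Prop :=
  IsZariskiGeneric 3 (fun f : MvPolynomial (Fin 3) ℂ => reducedStabilizerPeriod 3 f = 2) ∧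
  IsZariskiGeneric 4 (fun f : MvPolynomial (Fin 3) ℂ => reducedStabilizerPeriod 4 f = 2) ∧
  ∀ D : ℕ, 5 ≤ D →
    IsZariskiGeneric D (fun f : MvPolynomial (Fin 3) ℂ =>
      HasTrivialStabilizer D f ∧ reducedStabilizerPeriod D f = 1)

end Appendix

/-! ### Proof of the core of Lemma 6.3 (`t w ∈ SL_m w ↔ t^{b(w)} = 1`) -/

section LemmaSixThree

variable {m : ℕ}

/-- **`det(stab(w)) = μ_{a(w)}`** (BI 2017 §2.1, L430–436: "either `H = ℂ^×` or `H` is a finite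
subgroup of the group `ℂ^×` and hence cyclic"; used as "Since `det(stab(w)) = μ_{a(w)}`" in the proof
of Lemma 6.3, L2692): a finite `H` of order `a(w)` is the group of `a(w)`-th roots of unity.
[cite: BurgisserIkenmeyer2017, §2.1] -/
theorem stabilizerDetImage_eq_rootsOfUnity (f : MvPolynomial (Fin m) ℂ) (ha : stabilizerPeriod f ≠ 0) :
    stabilizerDetImage f = rootsOfUnity (stabilizerPeriod f) ℂ := by
  haveI : NeZero (stabilizerPeriod f) := ⟨ha⟩
  refine Subgroup.eq_of_le_of_card_ge ?_ ?_
  · intro u hu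
    rw [mem_rootsOfUnity, ← orderOf_dvd_iff_pow_eq_one]
    exact Subgroup.orderOf_dvd_natCard _ hu
  · rw [Complex.card_rootsOfUnity]
    exact le_of_eq rfl

/-- **BI 2017, Lemma 6.3, elementary core — DISCHARGE** of `BI2017_lem_6_3_core`
(`\label{le:stab-piw}`, L2664–2700), following the printed proof: write `t = t_1^D`; if
`t w = g_s w` with `g_s ∈ SL_m` then `ι(t_1)⁻¹ g_s ∈ stab(w)`, so `t_1^{-m a(w)} = 1 = t^{b(w)}`
(`D b(w) = m a(w)`); conversely `t^{b(w)} = 1` gives `(t_1^m)⁻¹ ∈ μ_{a(w)} = det(stab(w))`, so some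
`g ∈ stab(w)` has `det g = t_1^{-m}` and `g_s := ι(t_1) g ∈ SL_m` satisfies `g_s w = t_1^D w = t w`.
[cite: BurgisserIkenmeyer2017, Lemma 6.3] -/
theorem BI2017_lem_6_3_core_holds : BI2017_lem_6_3_core := by
  intro m D f hD hf ha t ht
  classical
  have hDb : D * degreePeriod D f = m * stabilizerPeriod f := BI2017_eq_3_1 hf hD
  obtain ⟨t₁, ht₁⟩ := IsAlgClosed.exists_pow_nat_eq t hD   -- `t = t₁ ^ D`
  have ht₁0 : t₁ ≠ 0 := by
    rintro rfl
    rw [zero_pow hD.ne'] at ht₁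
    exact ht ht₁.symm
  have hpow : t ^ degreePeriod D f = t₁ ^ (m * stabilizerPeriod f) := by
    rw [← ht₁, ← pow_mul, hDb]
  -- scalar matrices
  have hdet : ∀ c : ℂ, Matrix.det (c • (1 : Matrix (Fin m) (Fin m) ℂ)) = c ^ m := fun c => by
    rw [Matrix.det_smul, Matrix.det_one, mul_one, Fintype.card_fin]
  have hscal : ∀ (c : ℂ) (p : MvPolynomial (Fin m) ℂ), p.IsHomogeneous D →
      linSubst (Fin m) ℂ (c • (1 : Matrix (Fin m) (Fin m) ℂ)) p = c ^ D • p := fun c p hp => by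
    rw [linSubst_smul_of_isHomogeneous hp, linSubst_one, AlgHom.id_apply]
  -- every element of `H` has `u ^ a(w) = 1`
  have hordH : ∀ u ∈ stabilizerDetImage f, u ^ stabilizerPeriod f = 1 := fun u hu =>
    orderOf_dvd_iff_pow_eq_one.mp (Subgroup.orderOf_dvd_natCard _ hu)
  constructor
  · -- (⇒): `t w = g w`, `g ∈ SL` ⇒ `γ := (t₁⁻¹ I) g ∈ stab(w)` with `det γ = t₁^{-m}`
    rintro ⟨g, hg⟩
    have hκ0 : Matrix.det (t₁⁻¹ • (1 : Matrix (Fin m) (Fin m) ℂ)) ≠ 0 := by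
      rw [hdet]; exact pow_ne_zero _ (inv_ne_zero ht₁0)
    let κ : GL (Fin m) ℂ := Matrix.GeneralLinearGroup.mkOfDetNeZero _ hκ0
    have hγ : κ * Matrix.SpecialLinearGroup.toGL g ∈ linStabilizer f := by
      rw [mem_linStabilizer, linSubstRep_apply, Units.val_mul, linSubst_mul, AlgHom.comp_apply]
      change linSubst (Fin m) ℂ (t₁⁻¹ • (1 : Matrix (Fin m) (Fin m) ℂ))
        (linSubst (Fin m) ℂ (g : Matrix (Fin m) (Fin m) ℂ) f) = f
      rw [← hg, map_smul, hscal _ f hf, smul_smul, ← ht₁, inv_pow, mul_inv_cancel₀ (pow_ne_zero _ ht₁0),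
        one_smul]
    have hu := hordH _ (Subgroup.mem_map_of_mem Matrix.GeneralLinearGroup.det hγ)
    -- read off in `ℂ`: `(t₁⁻¹)^m)^a = 1`
    have hval : ((Matrix.GeneralLinearGroup.det (κ * Matrix.SpecialLinearGroup.toGL g) : ℂˣ) : ℂ) =
        (t₁ ^ m)⁻¹ := by
      rw [map_mul, Units.val_mul, Matrix.GeneralLinearGroup.val_det_apply,
        Matrix.GeneralLinearGroup.val_det_apply]
      change Matrix.det (t₁⁻¹ • (1 : Matrix (Fin m) (Fin m) ℂ)) * Matrix.det (g : Matrix (Fin m) (Fin m) ℂ) = _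
      rw [hdet, g.det_coe, mul_one, inv_pow]
    have hu' := congrArg (fun u : ℂˣ => (u : ℂ)) hu
    simp only [Units.val_pow_eq_pow_val, Units.val_one, hval] at hu'
    rw [hpow]
    rw [inv_pow, inv_eq_one, ← pow_mul] at hu'
    exact hu'
  · -- (⇐): `t₁^{m a} = 1` ⇒ `(t₁^m)⁻¹ ∈ μ_a = H` ⇒ `∃ γ ∈ stab(w)` with `det γ = t₁^{-m}`;
    -- then `g := (t₁ I) γ ∈ SL` and `g w = t₁^D w = t w`
    intro htb
    rw [hpow] at htb
    have hm0 : t₁ ^ m ≠ 0 := pow_ne_zero _ ht₁0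
    set u : ℂˣ := Units.mk0 ((t₁ ^ m)⁻¹) (inv_ne_zero hm0) with hu
    have huH : u ∈ stabilizerDetImage f := by
      rw [stabilizerDetImage_eq_rootsOfUnity f ha, mem_rootsOfUnity]
      ext
      rw [Units.val_pow_eq_pow_val, hu, Units.val_mk0, Units.val_one, inv_pow, ← pow_mul, htb, inv_one]
    obtain ⟨γ, hγ, hγdet⟩ := (mem_stabilizerDetImage_iff f u).mp huH
    -- the matrix `(t₁ I) γ` has determinant one
    have hM : Matrix.det (t₁ • (γ : Matrix (Fin m) (Fin m) ℂ)) = 1 := by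
      rw [Matrix.det_smul, Fintype.card_fin]
      have : Matrix.det (γ : Matrix (Fin m) (Fin m) ℂ) = (t₁ ^ m)⁻¹ := by
        have := congrArg (fun u : ℂˣ => (u : ℂ)) hγdet
        simp only [Matrix.GeneralLinearGroup.val_det_apply, hu, Units.val_mk0] at this
        exact this
      rw [this, mul_inv_cancel₀ hm0]
    refine ⟨⟨t₁ • (γ : Matrix (Fin m) (Fin m) ℂ), hM⟩, ?_⟩
    change t • f = linSubst (Fin m) ℂ (t₁ • (γ : Matrix (Fin m) (Fin m) ℂ)) f
    have hγf : linSubst (Fin m) ℂ (γ : Matrix (Fin m) (Fin m) ℂ) f = f := by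
      have := hγ
      rw [mem_linStabilizer, linSubstRep_apply] at this
      exact this
    rw [linSubst_smul_of_isHomogeneous hf, hγf, ht₁]

end LemmaSixThree

/-! ### Thm. 2.5, the stabilizer period of `det_n`, proved -/

section TheoremTwoFivePeriodProof

open _root_.Matrix _root_.Literature.NumberTheory.DiophantineGeometry
open scoped Kronecker

variable {n : ℕ}

/-- `det(Xᵀ) = det(X)` for the generic matrix: renaming the variables along the index
transposition `(i,j) ↦ (j,i)` fixes `det_n` ("since `det(X) = det(Xᵀ)`", BI 2017 Thm. 2.5, L516).
[cite: BurgisserIkenmeyer2017, Thm. 2.5] -/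
private theorem rename_prodComm_detPoly :
    rename (Equiv.prodComm (Fin n) (Fin n)) (detPoly (Fin n) ℂ) = detPoly (Fin n) ℂ := by
  unfold detPoly
  rw [AlgHom.map_det]
  have h : (rename (Equiv.prodComm (Fin n) (Fin n)) :
        MvPolynomial (Fin n × Fin n) ℂ →ₐ[ℂ] MvPolynomial (Fin n × Fin n) ℂ).mapMatrix
        (mvPolynomialX (Fin n) (Fin n) ℂ) = (mvPolynomialX (Fin n) (Fin n) ℂ)ᵀ := by
    refine Matrix.ext fun i j => ?_
    simp [mvPolynomialX_apply, rename_X]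
  rw [h, det_transpose]

/-- `(N e_c)_r = N_{rc}`. [folklore] -/
private theorem mulVec_single_one_apply {ι : Type*} [Fintype ι] [DecidableEq ι]
    (N : Matrix ι ι ℂ) (c r : ι) : (N *ᵥ Pi.single c 1) r = N r c := by
  simp [Matrix.mulVec, dotProduct, Pi.single_apply]

/-- The coordinate vector `e_{(i,j)}` read as an `n × n` matrix is the matrix unit `E_{ij}`. [folklore] -/
private theorem of_single_toLex (i j : Fin n) :
    (Matrix.of fun c d : Fin n =>
        (Pi.single (toLex (i, j)) (1 : ℂ) : MatIdx n → ℂ) (toLex (c, d))) =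
      Matrix.of fun c d : Fin n => if c = i ∧ d = j then (1 : ℂ) else 0 := by
  ext c d
  simp only [Matrix.of_apply, Pi.single_apply, toLex_inj, Prod.mk.injEq]

/-- `(P E_{ij} Q)_{ab} = P_{ai} Q_{jb}`. [folklore] -/
private theorem sandwich_single_apply (P Q : Matrix (Fin n) (Fin n) ℂ) (i j a b : Fin n) :
    (P * Matrix.of (fun c d : Fin n => if c = i ∧ d = j then (1 : ℂ) else 0) * Q) a b =
      P a i * Q j b := by
  rw [Matrix.mul_apply, Finset.sum_eq_single_of_mem j (Finset.mem_univ j)]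
  · rw [Matrix.mul_apply, Finset.sum_eq_single_of_mem i (Finset.mem_univ i)]
    · simp
    · intro c _ hc
      simp [hc]
  · intro d _ hd
    rw [Matrix.mul_apply, Finset.sum_eq_zero, zero_mul]
    intro c _
    simp [hd]

/-- `(P E_{ij}ᵀ Q)_{ab} = P_{aj} Q_{ib}`. [folklore] -/
private theorem sandwich_single_transpose_apply (P Q : Matrix (Fin n) (Fin n) ℂ)
    (i j a b : Fin n) :
    (P * (Matrix.of (fun c d : Fin n => if c = i ∧ d = j then (1 : ℂ) else 0))ᵀ * Q) a b =
      P a j * Q i b := by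
  rw [Matrix.mul_apply, Finset.sum_eq_single_of_mem i (Finset.mem_univ i)]
  · rw [Matrix.mul_apply, Finset.sum_eq_single_of_mem j (Finset.mem_univ j)]
    · simp
    · intro c _ hc
      simp [hc]
  · intro d _ hd
    rw [Matrix.mul_apply, Finset.sum_eq_zero, zero_mul]
    intro c _
    simp [hd]

/-- **The determinant of a stabilizer element of `det_n` is `1` or `sgn` of the index
transposition** (BI 2017 Thm. 2.5 via Frobenius: `g` is `X ↦ AXB` — determinant
`det(A)^n det(B)^n = 1` — or `X ↦ AXᵀB`; here from the tree's proved Frobenius theorem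
`frobenius_detPreserver_unimodular_sandwich_holds` in the normalisation `det P = det Q = 1`,
transported along `toLex`). [cite: BurgisserIkenmeyer2017, Thm. 2.5] -/
private theorem det_of_mem_linStabilizer_detPoly (γ : GL (Fin n × Fin n) ℂ)
    (hγ : γ ∈ linStabilizer (detPoly (Fin n) ℂ)) :
    (γ : Matrix (Fin n × Fin n) (Fin n × Fin n) ℂ).det = 1 ∨
      (γ : Matrix (Fin n × Fin n) (Fin n × Fin n) ℂ).det =
        ((Equiv.Perm.sign (Equiv.prodComm (Fin n) (Fin n)) : ℤ) : ℂ) := by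
  classical
  have hA := mem_linStabilizer.mp hγ
  rw [linSubstRep_apply] at hA
  set A : Matrix (Fin n × Fin n) (Fin n × Fin n) ℂ :=
    ((γ : GL (Fin n × Fin n) ℂ) : Matrix (Fin n × Fin n) (Fin n × Fin n) ℂ) with hAdef
  set M : Matrix (MatIdx n) (MatIdx n) ℂ := Matrix.reindex toLex toLex A with hM
  have hMstab : linSubst (MatIdx n) ℂ M (detFormLex ℂ n) = detFormLex ℂ n := by
    unfold detFormLex
    rw [hM, ← rename_linSubst, hA]
  have hMe : ∀ i j a b : Fin n,
      (Mᵀ *ᵥ (Pi.single (toLex (i, j)) (1 : ℂ))) (toLex (a, b)) = A (i, j) (a, b) := by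
    intro i j a b
    rw [mulVec_single_one_apply, Matrix.transpose_apply, hM, Matrix.reindex_apply,
      Matrix.submatrix_apply]
    simp
  obtain ⟨P, Q, hP, hQ, hcase⟩ := frobenius_detPreserver_unimodular_sandwich_holds n M hMstab
  rcases hcase with hc | hc
  · left
    have hAeq : A = Pᵀ ⊗ₖ Q := by
      ext ⟨i, j⟩ ⟨a, b⟩
      have h := congrFun (congrFun (hc (Pi.single (toLex (i, j)) 1)) a) b
      rw [Matrix.of_apply, hMe, of_single_toLex, sandwich_single_apply] at h
      rw [h, Matrix.kronecker_apply, Matrix.transpose_apply]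
    rw [hAeq, det_kronecker, det_transpose, hP, hQ, one_pow, mul_one]
  · right
    have hAeq : A = (Pᵀ ⊗ₖ Q).submatrix (Equiv.prodComm (Fin n) (Fin n)) id := by
      ext ⟨i, j⟩ ⟨a, b⟩
      have h := congrFun (congrFun (hc (Pi.single (toLex (i, j)) 1)) a) b
      rw [Matrix.of_apply, hMe, of_single_toLex, sandwich_single_transpose_apply] at h
      rw [h, Matrix.submatrix_apply, id, Equiv.prodComm_apply, Prod.swap_prod_mk,
        Matrix.kronecker_apply, Matrix.transpose_apply]
    rw [hAeq, det_permute, det_kronecker, det_transpose, hP, hQ, one_pow, mul_one, mul_one]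

/-- `n(n-1)/2` is even iff `n ≡ 0, 1 (mod 4)`. [folklore] -/
private theorem even_half_mul_pred_iff (n : ℕ) :
    Even ((n * n - n) / 2) ↔ (n % 4 = 0 ∨ n % 4 = 1) := by
  rw [← Nat.mul_sub_one n]
  have h2 : 2 * (n * (n - 1) / 2) = n * (n - 1) :=
    Nat.two_mul_div_two_of_even (Nat.even_mul_pred_self n)
  have hmod : n * (n - 1) % 4 = (n % 4) * ((n - 1) % 4) % 4 := Nat.mul_mod _ _ _
  set t := n * (n - 1) with ht
  set m := t / 2 with hm
  rw [Nat.even_iff]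
  obtain ⟨r, hr⟩ : ∃ r, n % 4 = r := ⟨_, rfl⟩
  have hr4 : r < 4 := hr ▸ Nat.mod_lt _ (by norm_num)
  rw [hr] at hmod
  interval_cases r <;> omega

/-- The sign of the index transposition `τ : (i,j) ↦ (j,i)` of `[n]²` (an involution with `n`
fixed points, `sgn τ = (-1)^{n(n-1)/2}`) is `1` iff `n ≡ 0, 1 (mod 4)`. [folklore] -/
private theorem sign_prodComm_eq_one_iff :
    Equiv.Perm.sign (Equiv.prodComm (Fin n) (Fin n) : Equiv.Perm (Fin n × Fin n)) = 1 ↔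
      (n % 4 = 0 ∨ n % 4 = 1) := by
  set θ : Equiv.Perm (Fin n × Fin n) := Equiv.prodComm (Fin n) (Fin n) with hθ
  have hsq : θ ^ 2 = 1 := by
    ext p <;> simp [hθ, pow_two, Equiv.Perm.mul_apply]
  have hfp : Fintype.card (Function.fixedPoints θ) = n := by
    let e : Function.fixedPoints θ ≃ Fin n :=
      { toFun := fun p => p.1.1
        invFun := fun i => ⟨(i, i), Function.mem_fixedPoints_iff.mpr rfl⟩
        left_inv := by
          rintro ⟨⟨a, b⟩, hp⟩
          have hba : b = a := by
            have := congrArg Prod.fst (Function.mem_fixedPoints_iff.mp hp)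
            simpa [hθ] using this
          subst hba
          rfl
        right_inv := fun i => rfl }
    simpa using Fintype.card_congr e
  rw [Equiv.Perm.sign_of_pow_two_eq_one hsq, hfp, Fintype.card_prod, Fintype.card_fin,
    neg_one_pow_eq_one_iff_even (by decide), even_half_mul_pred_iff]

/-- **BI 2017, Thm. 2.5, the stabilizer period of `det_n`, PROVED**: `det(stab(det_n)) =
{1, sgn τ}` where `τ` is the index transposition (Frobenius: every stabilizer element is
`X ↦ AXB`, of determinant `det(A)^n det(B)^n = 1`, or `X ↦ AXᵀB`; the transposition itself
stabilizes `det_n`), and `sgn τ = (-1)^{n(n-1)/2} = -1` iff `n ≡ 2, 3 (mod 4)`; so the period is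
`2` for `n ≡ 2, 3` and `1` for `n ≡ 0, 1 (mod 4)`, as printed (L513–527).
[cite: BurgisserIkenmeyer2017, Thm. 2.5] -/
theorem BI2017_thm_2_5_period_holds : BI2017_thm_2_5_period := by
  intro n
  classical
  set θ : Equiv.Perm (Fin n × Fin n) := Equiv.prodComm (Fin n) (Fin n) with hθ
  have hA₀ : (θ.permMatrix ℂ).det ≠ 0 := by
    rw [det_permutation]
    exact Int.cast_ne_zero.mpr (Units.ne_zero _)
  set γ₀ : GL (Fin n × Fin n) ℂ := GeneralLinearGroup.mkOfDetNeZero _ hA₀ with hγ₀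
  have hγ₀coe : (γ₀ : Matrix (Fin n × Fin n) (Fin n × Fin n) ℂ) = θ.permMatrix ℂ := rfl
  have hγ₀mem : γ₀ ∈ linStabilizer (detPoly (Fin n) ℂ) := by
    rw [mem_linStabilizer, linSubstRep_apply, hγ₀coe, linSubst_permMatrix, hθ,
      Equiv.prodComm_symm]
    exact rename_prodComm_detPoly
  have hγ₀det : ((GeneralLinearGroup.det γ₀ : ℂˣ) : ℂ) = ((Equiv.Perm.sign θ : ℤ) : ℂ) := by
    rw [GeneralLinearGroup.val_det_apply, hγ₀coe, det_permutation]
  set ε : ℂˣ := GeneralLinearGroup.det γ₀ with hε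
  have hset : ((stabilizerDetImage (detPoly (Fin n) ℂ) : Subgroup ℂˣ) : Set ℂˣ) = {1, ε} := by
    ext u
    rw [SetLike.mem_coe, mem_stabilizerDetImage_iff, Set.mem_insert_iff, Set.mem_singleton_iff]
    constructor
    · rintro ⟨γ, hγ, rfl⟩
      rcases det_of_mem_linStabilizer_detPoly γ hγ with h | h
      · exact Or.inl (Units.ext (by rw [GeneralLinearGroup.val_det_apply, h, Units.val_one]))
      · refine Or.inr (Units.ext ?_)
        rw [GeneralLinearGroup.val_det_apply, h, ← hθ]
        exact hγ₀det.symm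
    · rintro (rfl | rfl)
      · exact ⟨1, Subgroup.one_mem _, map_one _⟩
      · exact ⟨γ₀, hγ₀mem, rfl⟩
  unfold stabilizerPeriod
  rw [← SetLike.coe_sort_coe, Nat.card_coe_set_eq, hset]
  by_cases h01 : n % 4 = 0 ∨ n % 4 = 1
  · rw [if_pos h01]
    have hs : Equiv.Perm.sign θ = 1 := sign_prodComm_eq_one_iff.mpr h01
    have hε1 : ε = 1 := Units.ext (by rw [hγ₀det, hs, Units.val_one, Int.cast_one, Units.val_one])
    rw [hε1, Set.pair_eq_singleton, Set.ncard_singleton]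
  · rw [if_neg h01]
    have hne : (1 : ℂˣ) ≠ ε := by
      intro h1
      apply h01
      apply sign_prodComm_eq_one_iff.mp
      have h2 : ((Equiv.Perm.sign θ : ℤ) : ℂ) = 1 := by rw [← hγ₀det, ← h1, Units.val_one]
      rcases Int.units_eq_one_or (Equiv.Perm.sign θ) with hs | hs
      · exact hs
      · rw [hs] at h2
        norm_num at h2
    exact Set.ncard_pair hne

end TheoremTwoFivePeriodProof

/-! ### Thm. 2.6, the stabilizer period of `per_n` (`n > 2`), proved -/

section TheoremTwoSixPeriodProof

open _root_.Matrix
open scoped Kronecker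

variable {n : ℕ}

/-- A ring homomorphism commutes with the permanent (expansion over permutations). [folklore] -/
private theorem ringHom_map_permanent' {ι : Type*} [Fintype ι] [DecidableEq ι] {A B F : Type*}
    [CommSemiring A] [CommSemiring B] [FunLike F A B] [RingHomClass F A B] (f : F)
    (M : Matrix ι ι A) : f M.permanent = (M.map f).permanent := by
  simp [Matrix.permanent, map_sum, map_prod]

/-- `per(Xᵀ) = per(X)` for the generic matrix: the index transposition stabilizes `per_n`
(Marcus–May's `τ`, BI 2017 Thm. 2.6, L532). [cite: BurgisserIkenmeyer2017, Thm. 2.6] -/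
private theorem rename_prodComm_perPoly :
    rename (Equiv.prodComm (Fin n) (Fin n)) (perPoly (Fin n) ℂ) = perPoly (Fin n) ℂ := by
  unfold perPoly
  rw [ringHom_map_permanent']
  have h : (mvPolynomialX (Fin n) (Fin n) ℂ).map (rename (Equiv.prodComm (Fin n) (Fin n))) =
      (mvPolynomialX (Fin n) (Fin n) ℂ)ᵀ := by
    refine Matrix.ext fun i j => ?_
    simp [mvPolynomialX_apply, rename_X]
  rw [h, permanent_transpose]

/-- A row permutation `X ↦ P_σ X` of the variables stabilizes `per_n` (BI 2017 Thm. 2.6: the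
`g_{A,B}` with `A`, `B` permutation matrices, L533). [cite: BurgisserIkenmeyer2017, Thm. 2.6] -/
private theorem rename_prodCongr_perPoly_aux (σ : Equiv.Perm (Fin n)) :
    rename (Equiv.prodCongr σ (Equiv.refl (Fin n))) (perPoly (Fin n) ℂ) = perPoly (Fin n) ℂ := by
  unfold perPoly
  rw [ringHom_map_permanent']
  have h : (mvPolynomialX (Fin n) (Fin n) ℂ).map (rename (Equiv.prodCongr σ (Equiv.refl (Fin n)))) =
      (mvPolynomialX (Fin n) (Fin n) ℂ).submatrix σ id := by
    refine Matrix.ext fun i j => ?_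
    simp [mvPolynomialX_apply, rename_X]
  rw [h, permanent_permute_cols]

/-- The coordinate vector `e_{(i,j)}` read as an `n × n` matrix is the matrix unit `E_{ij}`. [folklore] -/
private theorem of_single_pair (i j : Fin n) :
    (Matrix.of fun c d : Fin n => (Pi.single (i, j) (1 : ℂ) : Fin n × Fin n → ℂ) (c, d)) =
      Matrix.of fun c d : Fin n => if c = i ∧ d = j then (1 : ℂ) else 0 := by
  ext c d
  simp only [Matrix.of_apply, Pi.single_apply, Prod.mk.injEq]

/-- **The determinant of a stabilizer element of `per_n`, `n ≥ 3`, is `(sgn π sgn ρ)^n` or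
`sgn τ · (sgn π sgn ρ)^n`** (Marcus–May: `g` acts as the monomial sandwich `X ↦ D P_π X P_ρ L`,
`(∏ d)(∏ l) = 1`, or that composed with the transposition `τ`); in particular it is `± 1`, and `1`
or `sgn τ` when `n` is even. From the tree's proved `marcusMay1962_perPreserver_sandwich_holds`.
[cite: BurgisserIkenmeyer2017, Thm. 2.6] -/
private theorem det_of_mem_linStabilizer_perPoly (hn : 3 ≤ n) (γ : GL (Fin n × Fin n) ℂ)
    (hγ : γ ∈ linStabilizer (perPoly (Fin n) ℂ)) :
    ∃ e : ℤ, (e = 1 ∨ e = -1) ∧ (γ : Matrix (Fin n × Fin n) (Fin n × Fin n) ℂ).det = (e : ℂ) ∧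
      (Even n → e = 1 ∨ e = ((Equiv.Perm.sign (Equiv.prodComm (Fin n) (Fin n)) : ℤˣ) : ℤ)) := by
  classical
  obtain ⟨π, ρ, d, l, hdl, hcase⟩ :=
    marcusMay1962_perPreserver_sandwich_holds.of_mem_linStabilizer hn hγ
  set A : Matrix (Fin n × Fin n) (Fin n × Fin n) ℂ :=
    ((γ : GL (Fin n × Fin n) ℂ) : Matrix (Fin n × Fin n) (Fin n × Fin n) ℂ) with hAdef
  set S : Matrix (Fin n) (Fin n) ℂ := diagonal d * π.permMatrix ℂ with hS
  set T : Matrix (Fin n) (Fin n) ℂ := ρ.permMatrix ℂ * diagonal l with hT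
  set w : ℤ := ((Equiv.Perm.sign π : ℤˣ) : ℤ) * ((Equiv.Perm.sign ρ : ℤˣ) : ℤ) with hw
  have hw1 : w = 1 ∨ w = -1 := by
    rcases Int.units_eq_one_or (Equiv.Perm.sign π) with h₁ | h₁ <;>
      rcases Int.units_eq_one_or (Equiv.Perm.sign ρ) with h₂ | h₂ <;> simp [hw, h₁, h₂]
  have hwn : w ^ n = 1 ∨ w ^ n = -1 := by
    rcases hw1 with h | h
    · exact Or.inl (by rw [h, one_pow])
    · rw [h]; exact neg_one_pow_eq_or ℤ n
  have heven : Even n → w ^ n = 1 := by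
    intro he
    rcases hw1 with h | h
    · rw [h, one_pow]
    · rw [h]; exact he.neg_one_pow
  have hMe : ∀ i j a b : Fin n,
      (Aᵀ *ᵥ (Pi.single (i, j) (1 : ℂ))) (a, b) = A (i, j) (a, b) := by
    intro i j a b
    rw [mulVec_single_one_apply, Matrix.transpose_apply]
  have hST : (Sᵀ).det ^ n * T.det ^ n = ((w ^ n : ℤ) : ℂ) := by
    rw [Int.cast_pow, hw, Int.cast_mul, det_transpose, hS, hT, det_mul, det_diagonal,
      det_permutation, det_mul, det_permutation, det_diagonal, ← mul_pow]
    have hre : (∏ i, d i) * ((Equiv.Perm.sign π : ℤ) : ℂ) *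
        (((Equiv.Perm.sign ρ : ℤ) : ℂ) * ∏ i, l i) =
        ((Equiv.Perm.sign π : ℤ) : ℂ) * ((Equiv.Perm.sign ρ : ℤ) : ℂ) *
          ((∏ i, d i) * ∏ i, l i) := by ring
    rw [hre, hdl, mul_one]
  rcases hcase with hc | hc
  · refine ⟨w ^ n, hwn, ?_, fun he => Or.inl (heven he)⟩
    have hAeq : A = Sᵀ ⊗ₖ T := by
      ext ⟨i, j⟩ ⟨a, b⟩
      have h := congrFun (congrFun (hc (Pi.single (i, j) 1)) a) b
      rw [Matrix.of_apply, hMe, of_single_pair, mul_assoc, ← hT, sandwich_single_apply] at h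
      rw [h, Matrix.kronecker_apply, Matrix.transpose_apply]
    rw [hAeq, det_kronecker, Fintype.card_fin, hST]
  · refine ⟨((Equiv.Perm.sign (Equiv.prodComm (Fin n) (Fin n)) : ℤˣ) : ℤ) * w ^ n, ?_, ?_,
      fun he => Or.inr (by rw [heven he, mul_one])⟩
    · rcases Int.units_eq_one_or (Equiv.Perm.sign (Equiv.prodComm (Fin n) (Fin n))) with h | h <;>
        rcases hwn with h' | h' <;> simp [h, h']
    · have hAeq : A = (Sᵀ ⊗ₖ T).submatrix (Equiv.prodComm (Fin n) (Fin n)) id := by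
        ext ⟨i, j⟩ ⟨a, b⟩
        have h := congrFun (congrFun (hc (Pi.single (i, j) 1)) a) b
        rw [Matrix.of_apply, hMe, of_single_pair, mul_assoc, ← hT,
          sandwich_single_transpose_apply] at h
        rw [h, Matrix.submatrix_apply, id, Equiv.prodComm_apply, Prod.swap_prod_mk,
          Matrix.kronecker_apply, Matrix.transpose_apply]
      rw [hAeq, det_permute, det_kronecker, Fintype.card_fin, hST, Int.cast_mul]

/-- **BI 2017, Thm. 2.6 (Marcus and May), the stabilizer period of `per_n`, PROVED** (`n > 2`):
`det(stab(per_n)) ⊆ {±1}` (every stabilizer element is a monomial sandwich `X ↦ D P_π X P_ρ L` with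
`per(D) per(L) = 1`, of determinant `(sgn π sgn ρ)^n`, possibly composed with the transposition
`τ`, of determinant `sgn τ = (-1)^{n(n-1)/2}`); `-1` is attained by a row transposition when `n`
is odd and by `τ` when `n ≡ 2 (mod 4)`, and is not attained when `n ≡ 0 (mod 4)`. Hence the period
is `2` unless `n ≡ 0 (mod 4)`, as printed (L530–546). [cite: BurgisserIkenmeyer2017, Thm. 2.6] -/
theorem BI2017_thm_2_6_period_holds : BI2017_thm_2_6_period := by
  intro n hn2
  have hn : 3 ≤ n := hn2
  classical
  set θ : Equiv.Perm (Fin n × Fin n) := Equiv.prodComm (Fin n) (Fin n) with hθ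
  -- every determinant of a stabilizer element is `± 1`
  have hsub : ∀ u ∈ stabilizerDetImage (perPoly (Fin n) ℂ), u = 1 ∨ u = -1 := by
    intro u hu
    obtain ⟨γ, hγ, rfl⟩ := (mem_stabilizerDetImage_iff _ _).mp hu
    obtain ⟨e, he1, hdet, -⟩ := det_of_mem_linStabilizer_perPoly hn γ hγ
    rcases he1 with rfl | rfl
    · exact Or.inl (Units.ext (by rw [GeneralLinearGroup.val_det_apply, hdet]; simp))
    · exact Or.inr (Units.ext (by rw [GeneralLinearGroup.val_det_apply, hdet]; simp))
  -- witness (W2): the index transposition, determinant `sgn θ`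
  have hA₀ : (θ.permMatrix ℂ).det ≠ 0 := by
    rw [det_permutation]
    exact Int.cast_ne_zero.mpr (Units.ne_zero _)
  set γ₀ : GL (Fin n × Fin n) ℂ := GeneralLinearGroup.mkOfDetNeZero _ hA₀ with hγ₀
  have hγ₀coe : (γ₀ : Matrix (Fin n × Fin n) (Fin n × Fin n) ℂ) = θ.permMatrix ℂ := rfl
  have hγ₀mem : γ₀ ∈ linStabilizer (perPoly (Fin n) ℂ) := by
    rw [mem_linStabilizer, linSubstRep_apply, hγ₀coe, linSubst_permMatrix, hθ,
      Equiv.prodComm_symm]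
    exact rename_prodComm_perPoly
  have hγ₀det : ((GeneralLinearGroup.det γ₀ : ℂˣ) : ℂ) = ((Equiv.Perm.sign θ : ℤ) : ℂ) := by
    rw [GeneralLinearGroup.val_det_apply, hγ₀coe, det_permutation]
  -- witness (W1): the row transposition `(0 1)`, determinant `(-1)^n`
  set a₀ : Fin n := ⟨0, by omega⟩ with ha₀
  set a₁ : Fin n := ⟨1, by omega⟩ with ha₁
  have h01 : a₀ ≠ a₁ := by simp [ha₀, ha₁, Fin.ext_iff]
  set θ₁ : Equiv.Perm (Fin n × Fin n) :=
    Equiv.prodCongr (Equiv.swap a₀ a₁) (Equiv.refl (Fin n)) with hθ₁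
  have hA₁ : (θ₁.permMatrix ℂ).det ≠ 0 := by
    rw [det_permutation]
    exact Int.cast_ne_zero.mpr (Units.ne_zero _)
  set γ₁ : GL (Fin n × Fin n) ℂ := GeneralLinearGroup.mkOfDetNeZero _ hA₁ with hγ₁
  have hγ₁coe : (γ₁ : Matrix (Fin n × Fin n) (Fin n × Fin n) ℂ) = θ₁.permMatrix ℂ := rfl
  have hγ₁mem : γ₁ ∈ linStabilizer (perPoly (Fin n) ℂ) := by
    rw [mem_linStabilizer, linSubstRep_apply, hγ₁coe, linSubst_permMatrix, hθ₁,
      Equiv.prodCongr_symm, Equiv.symm_swap, Equiv.refl_symm]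
    exact rename_prodCongr_perPoly_aux (Equiv.swap a₀ a₁)
  have hγ₁det : ((GeneralLinearGroup.det γ₁ : ℂˣ) : ℂ) = (-1) ^ n := by
    rw [GeneralLinearGroup.val_det_apply, hγ₁coe, det_permutation, hθ₁, Equiv.prodCongr_refl_right,
      Equiv.Perm.sign_prodCongrLeft, Finset.prod_const, Finset.card_univ, Fintype.card_fin,
      Equiv.Perm.sign_swap h01]
    push_cast
    ring
  by_cases h0 : n % 4 = 0
  · rw [if_pos h0]
    have he : Even n := Nat.even_iff.mpr (by omega)
    have hsθ : Equiv.Perm.sign θ = 1 := sign_prodComm_eq_one_iff.mpr (Or.inl h0)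
    have hset : ((stabilizerDetImage (perPoly (Fin n) ℂ) : Subgroup ℂˣ) : Set ℂˣ) = {1} := by
      ext u
      rw [SetLike.mem_coe, Set.mem_singleton_iff]
      constructor
      · intro hu
        obtain ⟨γ, hγ, rfl⟩ := (mem_stabilizerDetImage_iff _ _).mp hu
        obtain ⟨e, -, hdet, hev⟩ := det_of_mem_linStabilizer_perPoly hn γ hγ
        have hε : e = 1 := by
          rcases hev he with h | h
          · exact h
          · rw [h, ← hθ, hsθ, Units.val_one]
        apply Units.ext
        rw [GeneralLinearGroup.val_det_apply, hdet, hε]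
        simp
      · rintro rfl
        exact Subgroup.one_mem _
    unfold stabilizerPeriod
    rw [← SetLike.coe_sort_coe, Nat.card_coe_set_eq, hset, Set.ncard_singleton]
  · rw [if_neg h0]
    have hneg : (-1 : ℂˣ) ∈ stabilizerDetImage (perPoly (Fin n) ℂ) := by
      rw [mem_stabilizerDetImage_iff]
      rcases Nat.even_or_odd n with he | ho
      · -- `n ≡ 2 (mod 4)`: the index transposition has determinant `sgn θ = -1`
        refine ⟨γ₀, hγ₀mem, Units.ext ?_⟩
        have hsθ : Equiv.Perm.sign θ = -1 := by
          rcases Int.units_eq_one_or (Equiv.Perm.sign θ) with h | h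
          · exfalso
            have := sign_prodComm_eq_one_iff.mp (hθ ▸ h)
            rcases he with ⟨k, hk⟩
            omega
          · exact h
        rw [hγ₀det, hsθ]
        simp
      · -- `n` odd: the row transposition has determinant `(-1)^n = -1`
        refine ⟨γ₁, hγ₁mem, Units.ext ?_⟩
        rw [hγ₁det, ho.neg_one_pow]
        simp
    have hset : ((stabilizerDetImage (perPoly (Fin n) ℂ) : Subgroup ℂˣ) : Set ℂˣ) = {1, -1} := by
      ext u
      rw [SetLike.mem_coe, Set.mem_insert_iff, Set.mem_singleton_iff]
      constructor
      · exact hsub u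
      · rintro (rfl | rfl)
        · exact Subgroup.one_mem _
        · exact hneg
    have hne : (1 : ℂˣ) ≠ -1 := by
      intro h
      have h' := congrArg (fun u : ℂˣ => (u : ℂ)) h
      norm_num at h'
    unfold stabilizerPeriod
    rw [← SetLike.coe_sort_coe, Nat.card_coe_set_eq, hset, Set.ncard_pair hne]

end TheoremTwoSixPeriodProof


end Literature.Computability.AlgebraicComplexity

end
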